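import Literature.Computability.QuantumComplexity.ZXCalculusTwoTriangleCycle
import HarnessLib

/-!
# ZX-calculus: JPV LICS 2019, Lemma `control-alpha-with-triangles`

`X^{(1,2)} ⨾ ((Z(2α) ⨾ Tᵗ) ⊗ (Tᵗ ⨾ X(π))) ⨾ Z^{(2,1)} = Z(α) ⨾ xLeafL 0 (-α) ⨾ Z(α)`, following the printed proof
(gadget removal, Euler conjugation, two bialgebra steps, (C1) twice, an `H`-loop and the leafy four-cycle), with the
intermediate diagrams re-expressed in PROP form. [cite: JeandelPerdrixVilmart2018, Fig. 1; JPV LICS 2019 Appendix]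
-/

namespace Literature.Computability.QuantumComplexity

open ZXDiagram

namespace ZXClass

/-- **Euler conjugation**: `X(π/2) ⨾ Z(θ) ⨾ X(π/2) = 1/√2 ⊗ db 4 2 ⊗ (Z(-π/2) ⨾ X(θ+π) ⨾ Z(-π/2))`.
[cite: JeandelPerdrixVilmart2018, Fig. 1 (EU), (H)] -/
theorem euler_conj (t : ZMod 8) :
    mk (X 1 1 2) ⨟ mk (Z 1 1 t) ⨟ mk (X 1 1 2) = mk invSqrtTwo ⊠ (mk (dumbbell 4 2) ⊠ (mk (Z 1 1 (-2)) ⨟ mk (X 1 1 (t + 4)) ⨟ mk (Z 1 1 (-2)))) := by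
  have hX : mk (X 1 1 2) = mk invSqrtTwo ⊠ (mk (dumbbell 4 1) ⊠ (mk (Z 1 1 (-2)) ⨟ mk hBox ⨟ mk (Z 1 1 (-2)))) := by
    rw [X_halfpi_eq_euler, seq_scalar_par_one, seq_scalar_par_one, scalar_par_seq_one, scalar_par_seq_one]
  have hE : (mk (Z 1 1 (-2)) ⨟ mk hBox ⨟ mk (Z 1 1 (-2))) ⨟ mk (Z 1 1 t) ⨟ (mk (Z 1 1 (-2)) ⨟ mk hBox ⨟ mk (Z 1 1 (-2))) =
      mk (Z 1 1 (-2)) ⨟ mk (X 1 1 (t + 4)) ⨟ mk (Z 1 1 (-2)) := by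
    simp only [seq_assoc]
    rw [← seq_assoc (mk (Z 1 1 (-2))) (mk (Z 1 1 t)), Z_seq_Z 1 1 1 le_rfl, ← seq_assoc (mk (Z 1 1 (-2 + t))) (mk (Z 1 1 (-2))), Z_seq_Z 1 1 1 le_rfl,
      show (-2 : ZMod 8) + t + -2 = t + 4 from by rw [add_right_comm, show (-2 : ZMod 8) + -2 = 4 from by decide, add_comm], ← seq_assoc (mk hBox) (mk (Z 1 1 (t + 4))), hBox_seq_Z_phase, seq_assoc (mk (X 1 1 (t + 4))),
      ← seq_assoc (mk hBox) (mk hBox), hBox_seq_hBox, id_seq]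
  rw [hX]
  simp only [scalar_par_seq_one, seq_scalar_par_one]
  rw [hE, scalar_par_scalar_par (mk (dumbbell 4 1)) (mk invSqrtTwo),
    show ∀ Y : ZXClass 1 1, mk (dumbbell 4 1) ⊠ (mk (dumbbell 4 1) ⊠ Y) = (mk (dumbbell 4 1) ⊠ mk (dumbbell 4 1)) ⊠ Y from fun Y => (par_assoc' _ _ _).trans (cast_id _ _ _),
    dumbbell_four_mul, show (1 : ZMod 8) + 1 = 2 from rfl,
    show ∀ Y : ZXClass 1 1, (mk (dumbbell 4 2) ⊠ mk (dumbbell 0 0)) ⊠ Y = mk (dumbbell 4 2) ⊠ (mk (dumbbell 0 0) ⊠ Y) from fun Y => (par_assoc _ _ _).trans (cast_id _ _ _),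
    scalar_par_scalar_par (mk invSqrtTwo) (mk (dumbbell 4 2)), invSqrtTwo_par_sqrt_two_par_one, scalar_par_scalar_par (mk invSqrtTwo) (mk (dumbbell 4 2))]

/-- `(𝕀² ⊗ Z^{(0,3)}) ⨾ σ₂₃`: the copy on the cup's second leg commutes past the crossing. [cite: JeandelPerdrixVilmart2018, §2.2] -/
theorem wires_par_Z_zero_three_seq_swap :
    (mk (wires 2) ⊠ mk (Z 0 3 0)) ⨟ (((mk (wires 1) ⊠ mk swap) ⊠ mk (wires 1)) ⊠ mk (wires 1)) =
      (mk (wires 1) ⊠ ((mk (wires 1) ⊠ mk cup) ⨟ (mk swap ⊠ mk (wires 1)))) ⨟ (mk (wires 3) ⊠ mk (Z 1 2 0)) := by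
  rw [Z_zero_three_eq_cup_par_split, wires_par_seq, seq_assoc,
    show (mk (wires 2) ⊠ (mk (wires 1) ⊠ mk (Z 1 2 0))) ⨟ (((mk (wires 1) ⊠ mk swap) ⊠ mk (wires 1)) ⊠ mk (wires 1)) =
      ((mk (wires 1) ⊠ mk swap) ⊠ mk (wires 1)) ⨟ (mk (wires 3) ⊠ mk (Z 1 2 0)) from by
        rw [show mk (wires 2) ⊠ (mk (wires 1) ⊠ mk (Z 1 2 0)) = mk (wires 3) ⊠ mk (Z 1 2 0) from by
            rw [← wires_par_wires 2 1]; exact (par_assoc' _ _ _).trans (cast_id _ _ _),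
          show ((mk (wires 1) ⊠ mk swap) ⊠ mk (wires 1)) ⊠ mk (wires 1) = (mk (wires 1) ⊠ mk swap) ⊠ mk (wires 2) from by
            rw [← wires_par_wires 1 1]; exact (par_assoc _ _ _).trans (cast_id _ _ _),
          interchange, id_seq, seq_id, par_eq_seq_left (mk (wires 1) ⊠ mk swap) (mk (Z 1 2 0))],
    ← seq_assoc, ← wires_par_wires 1 1,
    show (mk (wires 1) ⊠ mk (wires 1)) ⊠ mk cup = mk (wires 1) ⊠ (mk (wires 1) ⊠ mk cup) from (par_assoc _ _ _).trans (cast_id _ _ _),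
    show (mk (wires 1) ⊠ mk swap) ⊠ mk (wires 1) = mk (wires 1) ⊠ (mk swap ⊠ mk (wires 1)) from (par_assoc _ _ _).trans (cast_id _ _ _),
    ← wires_par_seq]

/-- **Second yanking of `Z^{(0,3)}`**: merging its first leg by `X^{(2,1)}` and capping the second gives the
bent "red split feeding a green merge": `(𝕀² ⊗ Z^{(0,3)}) ⨾ σ₂₃ ⨾ (X^{(2,1)} ⊗ ∪ᵗ ⊗ 𝕀) = (X^{(1,2)} ⊗ 𝕀) ⨾ (𝕀 ⊗ Z^{(2,1)})`.
[cite: JeandelPerdrixVilmart2018, §2.2] -/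
theorem wires_par_Z_zero_three_yank_xmerge :
    (mk (wires 2) ⊠ mk (Z 0 3 0)) ⨟ (((mk (wires 1) ⊠ mk swap) ⊠ mk (wires 1)) ⊠ mk (wires 1)) ⨟ ((mk (X 2 1 0) ⊠ mk cap) ⊠ mk (wires 1)) =
      (mk (X 1 2 0) ⊠ mk (wires 1)) ⨟ (mk (wires 1) ⊠ mk (Z 2 1 0)) := by
  have hbend : (mk (wires 1) ⊠ mk (Z 1 2 0)) ⨟ (mk cap ⊠ mk (wires 1)) = mk (Z 2 1 0) := by
    have h := congrArg colorSwap par_xsplit_seq_cap_par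
    simpa using h
  have hC : (mk (X 2 1 0) ⊠ mk cap) ⊠ mk (wires 1) = (mk (X 2 1 0) ⊠ mk (wires 3)) ⨟ ((mk (wires 1) ⊠ mk cap) ⊠ mk (wires 1)) := by
    rw [par_eq_seq_left (mk (X 2 1 0)) (mk cap), seq_par_wires,
      show (mk (X 2 1 0) ⊠ mk (wires 2)) ⊠ mk (wires 1) = mk (X 2 1 0) ⊠ mk (wires 3) from by rw [← wires_par_wires 2 1]; exact (par_assoc _ _ _).trans (cast_id _ _ _)]
  have hZ : (mk (wires 3) ⊠ mk (Z 1 2 0)) ⨟ (mk (X 2 1 0) ⊠ mk (wires 3)) = (mk (X 2 1 0) ⊠ mk (wires 2)) ⨟ (mk (wires 1) ⊠ (mk (wires 1) ⊠ mk (Z 1 2 0))) := by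
    rw [show mk (wires 3) ⊠ mk (Z 1 2 0) = mk (wires 2) ⊠ (mk (wires 1) ⊠ mk (Z 1 2 0)) from by rw [← wires_par_wires 2 1]; exact (par_assoc _ _ _).trans (cast_id _ _ _),
      show mk (X 2 1 0) ⊠ mk (wires 3) = mk (X 2 1 0) ⊠ (mk (wires 1) ⊠ mk (wires 2)) from by rw [wires_par_wires],
      interchange, id_seq, wires_par_wires, seq_id, par_eq_seq_left (mk (X 2 1 0)) (mk (wires 1) ⊠ mk (Z 1 2 0))]
  have hS : (mk (wires 1) ⊠ (mk (wires 1) ⊠ mk swap)) ⨟ (mk (X 2 1 0) ⊠ mk (wires 2)) = (mk (X 2 1 0) ⊠ mk (wires 2)) ⨟ (mk (wires 1) ⊠ mk swap) := by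
    rw [show mk (wires 1) ⊠ (mk (wires 1) ⊠ mk swap) = mk (wires 2) ⊠ mk swap from by rw [← wires_par_wires 1 1]; exact (par_assoc' _ _ _).trans (cast_id _ _ _),
      interchange, id_seq, seq_id, par_eq_seq_left (mk (X 2 1 0)) (mk swap)]
  have hx : (mk (wires 1) ⊠ (mk cup ⊠ mk (wires 1))) ⨟ (mk (X 2 1 0) ⊠ mk (wires 2)) = mk (X 1 2 0) ⊠ mk (wires 1) := by
    rw [show mk (wires 1) ⊠ (mk cup ⊠ mk (wires 1)) = (mk (wires 1) ⊠ mk cup) ⊠ mk (wires 1) from (par_assoc' _ _ _).trans (cast_id _ _ _),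
      show mk (X 2 1 0) ⊠ mk (wires 2) = (mk (X 2 1 0) ⊠ mk (wires 1)) ⊠ mk (wires 1) from by rw [← wires_par_wires 1 1]; exact (par_assoc' _ _ _).trans (cast_id _ _ _),
      ← seq_par_wires, par_cup_seq_xmerge_par]
  rw [wires_par_Z_zero_three_seq_swap, par_cup_swap_par, wires_par_seq, hC, seq_assoc, seq_assoc, ← seq_assoc (mk (wires 3) ⊠ mk (Z 1 2 0)) (mk (X 2 1 0) ⊠ mk (wires 3)), hZ,
    ← seq_assoc (mk (wires 1) ⊠ (mk (wires 1) ⊠ mk swap)), ← seq_assoc (mk (wires 1) ⊠ (mk (wires 1) ⊠ mk swap)), hS,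
    ← seq_assoc (mk (wires 1) ⊠ (mk cup ⊠ mk (wires 1))), ← seq_assoc (mk (wires 1) ⊠ (mk cup ⊠ mk (wires 1))),
    ← seq_assoc (mk (wires 1) ⊠ (mk cup ⊠ mk (wires 1))), hx, seq_assoc, seq_assoc,
    show (mk (wires 1) ⊠ mk cap) ⊠ mk (wires 1) = mk (wires 1) ⊠ (mk cap ⊠ mk (wires 1)) from (par_assoc _ _ _).trans (cast_id _ _ _),
    ← wires_par_seq, hbend, ← wires_par_seq, swap_seq_Z]

/-- **A red split followed by a green phase is a bent bialgebra square**: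
`X^{(1,2)} ⨾ (Z(γ) ⊗ 𝕀) = √2 ⊗ (Z^{(1,2)} ⨾ (X^{(1,2)} ⊗ xLeafL 0 γ) ⨾ (𝕀 ⊗ Z^{(2,1)}))` ((B2) plugged with the state `Z^{(0,1)}(γ)`
and bent). [cite: JeandelPerdrixVilmart2018, Fig. 1 (B2)] -/
theorem xsplit_seq_Z_phase_par (c : ZMod 8) :
    mk (X 1 2 0) ⨟ (mk (Z 1 1 c) ⊠ mk (wires 1)) = mk (dumbbell 0 0) ⊠ (mk (Z 1 2 0) ⨟ (mk (X 1 2 0) ⊠ mk (xLeafL 0 c)) ⨟ (mk (wires 1) ⊠ mk (Z 2 1 0))) := by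
  have g1 : mk (wires 2) ⊠ (mk (xLeafL 0 c) ⊠ mk (wires 1)) = (mk (wires 1) ⊠ (mk (wires 1) ⊠ mk (xLeafL 0 c))) ⊠ mk (wires 1) := by
    have e1 : (mk (wires 1) ⊠ mk (wires 1)) ⊠ (mk (xLeafL 0 c) ⊠ mk (wires 1)) = mk (wires 1) ⊠ (mk (wires 1) ⊠ (mk (xLeafL 0 c) ⊠ mk (wires 1))) := (par_assoc _ _ _).trans (cast_id _ _ _)
    have e2 : mk (wires 1) ⊠ (mk (xLeafL 0 c) ⊠ mk (wires 1)) = (mk (wires 1) ⊠ mk (xLeafL 0 c)) ⊠ mk (wires 1) := (par_assoc' _ _ _).trans (cast_id _ _ _)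
    have e3 : mk (wires 1) ⊠ ((mk (wires 1) ⊠ mk (xLeafL 0 c)) ⊠ mk (wires 1)) = (mk (wires 1) ⊠ (mk (wires 1) ⊠ mk (xLeafL 0 c))) ⊠ mk (wires 1) := (par_assoc' _ _ _).trans (cast_id _ _ _)
    rw [← wires_par_wires 1 1, e1, e2, e3]
  have g2 : (mk (wires 1) ⊠ (mk (xLeafL 0 c) ⊠ mk (wires 1))) ⊠ mk (wires 1) = (mk (wires 1) ⊠ mk (xLeafL 0 c)) ⊠ mk (wires 2) := by
    have e1 : (mk (wires 1) ⊠ (mk (xLeafL 0 c) ⊠ mk (wires 1))) ⊠ mk (wires 1) = mk (wires 1) ⊠ ((mk (xLeafL 0 c) ⊠ mk (wires 1)) ⊠ mk (wires 1)) := (par_assoc _ _ _).trans (cast_id _ _ _)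
    have e2 : (mk (xLeafL 0 c) ⊠ mk (wires 1)) ⊠ mk (wires 1) = mk (xLeafL 0 c) ⊠ mk (wires 2) := by rw [← wires_par_wires 1 1]; exact (par_assoc _ _ _).trans (cast_id _ _ _)
    have e3 : mk (wires 1) ⊠ (mk (xLeafL 0 c) ⊠ mk (wires 2)) = (mk (wires 1) ⊠ mk (xLeafL 0 c)) ⊠ mk (wires 2) := (par_assoc' _ _ _).trans (cast_id _ _ _)
    rw [e1, e2, e3]
  have hS : ((mk (wires 1) ⊠ mk swap) ⊠ mk (wires 1)) ⨟ (mk (wires 2) ⊠ (mk (xLeafL 0 c) ⊠ mk (wires 1))) = ((mk (wires 1) ⊠ mk (xLeafL 0 c)) ⊠ mk (wires 2)) ⨟ ((mk (wires 1) ⊠ mk swap) ⊠ mk (wires 1)) := by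
    rw [g1, ← seq_par_wires, ← wires_par_seq, swap_seq_par_one_one, wires_par_seq, seq_par_wires, g2]
  -- the wiring
  have hW : (mk (wires 1) ⊠ mk cup) ⨟ ((((mk (Z 1 2 0) ⊠ mk (Z 1 2 0)) ⨟ ((mk (wires 1) ⊠ mk swap) ⊠ mk (wires 1)) ⨟ (mk (X 2 1 0) ⊠ mk (X 2 1 0))) ⨟ (mk (wires 1) ⊠ mk (Z 1 0 c))) ⊠ mk (wires 1)) =
      mk (Z 1 2 0) ⨟ (mk (X 1 2 0) ⊠ mk (xLeafL 0 c)) ⨟ (mk (wires 1) ⊠ mk (Z 2 1 0)) := by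
    rw [seq_assoc (mk (Z 1 2 0) ⊠ mk (Z 1 2 0)), seq_assoc (mk (Z 1 2 0) ⊠ mk (Z 1 2 0)), seq_assoc ((mk (wires 1) ⊠ mk swap) ⊠ mk (wires 1)) (mk (X 2 1 0) ⊠ mk (X 2 1 0)),
      interchange (mk (X 2 1 0)) (mk (wires 1)) (mk (X 2 1 0)) (mk (Z 1 0 c)), seq_id, ← xLeafL_par_wire_seq_cap, ← id_seq (mk (X 2 1 0)),
      ← interchange (mk (wires 2)) (mk (X 2 1 0)) (mk (xLeafL 0 c) ⊠ mk (wires 1)) (mk cap),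
      ← seq_assoc ((mk (wires 1) ⊠ mk swap) ⊠ mk (wires 1)) (mk (wires 2) ⊠ (mk (xLeafL 0 c) ⊠ mk (wires 1))) (mk (X 2 1 0) ⊠ mk cap), hS,
      ← seq_assoc (mk (Z 1 2 0) ⊠ mk (Z 1 2 0)), ← seq_assoc (mk (Z 1 2 0) ⊠ mk (Z 1 2 0)),
      show (mk (Z 1 2 0) ⊠ mk (Z 1 2 0)) ⨟ ((mk (wires 1) ⊠ mk (xLeafL 0 c)) ⊠ mk (wires 2)) = (mk (Z 1 2 0) ⨟ (mk (wires 1) ⊠ mk (xLeafL 0 c))) ⊠ mk (Z 1 2 0) from by rw [interchange, seq_id],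
      seq_assoc ((mk (Z 1 2 0) ⨟ (mk (wires 1) ⊠ mk (xLeafL 0 c))) ⊠ mk (Z 1 2 0)), seq_par_wires,
      show ((mk (Z 1 2 0) ⨟ (mk (wires 1) ⊠ mk (xLeafL 0 c))) ⊠ mk (Z 1 2 0)) ⊠ mk (wires 1) = (mk (Z 1 2 0) ⨟ (mk (wires 1) ⊠ mk (xLeafL 0 c))) ⊠ (mk (Z 1 2 0) ⊠ mk (wires 1)) from
        (par_assoc _ _ _).trans (cast_id _ _ _),
      ← seq_assoc (mk (wires 1) ⊠ mk cup), interchange, id_seq, ← Z_zero_three_eq_cup_split_par,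
      par_eq_seq_left (mk (Z 1 2 0) ⨟ (mk (wires 1) ⊠ mk (xLeafL 0 c))) (mk (Z 0 3 0)), par_empty, seq_par_wires, seq_assoc,
      show mk (wires (1 + 1)) = mk (wires 2) from rfl, ← seq_assoc (mk (wires 2) ⊠ mk (Z 0 3 0)), wires_par_Z_zero_three_yank_xmerge,
      seq_assoc (mk (Z 1 2 0)) (mk (wires 1) ⊠ mk (xLeafL 0 c)), ← seq_assoc (mk (wires 1) ⊠ mk (xLeafL 0 c)) (mk (X 1 2 0) ⊠ mk (wires 1)),
      show (mk (wires 1) ⊠ mk (xLeafL 0 c)) ⨟ (mk (X 1 2 0) ⊠ mk (wires 1)) = mk (X 1 2 0) ⊠ mk (xLeafL 0 c) from by rw [interchange, id_seq, seq_id], ← seq_assoc]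
  rw [← hW, ← one_two_seq_scalar_par_two', ← scalar_par_two_one_par_one, ← scalar_par_two_two_seq_one', rule_B2, seq_assoc, Z_seq_par_Z 1 1 1 0 le_rfl, show mk (Z 1 (1 + 0) (0 + c)) = mk (Z 1 1 c) from by rw [zero_add],
    seq_par_wires, ← seq_assoc, par_cup_seq_xmerge_par]
  where
  one_two_seq_scalar_par_two' (A : ZXClass 1 3) (s : ZXClass 0 0) (B : ZXClass 3 2) : A ⨟ (s ⊠ B) = s ⊠ (A ⨟ B) := by
    rw [scalar_par_seq_right, empty_par, cast_id]
  scalar_par_two_one_par_one (s : ZXClass 0 0) (A : ZXClass 2 1) : (s ⊠ A) ⊠ mk (wires 1) = s ⊠ (A ⊠ mk (wires 1)) := (par_assoc _ _ _).trans (cast_id _ _ _)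
  scalar_par_two_two_seq_one' (s : ZXClass 0 0) (A : ZXClass 2 2) (B : ZXClass 2 1) : (s ⊠ A) ⨟ B = s ⊠ (A ⨟ B) := by
    rw [scalar_par_seq_left, empty_par, cast_id]

/-- `√2 ⊗ X(π/2) = db 4 1 ⊗ xLeafL 0 (-π/2)`: the red `π/2` phase as a leaf node. [cite: JeandelPerdrixVilmart2018, Appendix Lemma 15] -/
theorem sqrt_two_par_X_halfpi : mk (dumbbell 0 0) ⊠ mk (X 1 1 2) = mk (dumbbell 4 1) ⊠ mk (xLeafL 0 (-2)) := by
  rw [← par_Z_state_seq_X_merge (-2) 0, par_Z_state_neg_two_seq_X_merge, Z_dot_neg_two_eq, scalar_par_scalar_par (mk (dumbbell 4 1)) (mk invSqrtTwo),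
    show mk (dumbbell 4 1) ⊠ (mk (dumbbell 4 (-1)) ⊠ mk (X 1 1 2)) = (mk (dumbbell 4 1) ⊠ mk (dumbbell 4 (-1))) ⊠ mk (X 1 1 2) from (par_assoc' _ _ _).trans (cast_id _ _ _),
    dumbbell_four_mul, show (1 : ZMod 8) + -1 = 0 from by decide, dumbbell_four_zero,
    show (mk (dumbbell 0 0) ⊠ mk (dumbbell 0 0)) ⊠ mk (X 1 1 2) = mk (dumbbell 0 0) ⊠ (mk (dumbbell 0 0) ⊠ mk (X 1 1 2)) from (par_assoc _ _ _).trans (cast_id _ _ _),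
    invSqrtTwo_par_sqrt_two_par_one]

/-- `1/√2 ⊗ √2 ⊗ A = A` for `1 → 2` diagrams. [folklore] -/
theorem invSqrtTwo_par_sqrt_two_par_one_two (A : ZXClass 1 2) : mk invSqrtTwo ⊠ (mk (dumbbell 0 0) ⊠ A) = A := by
  rw [show mk invSqrtTwo ⊠ (mk (dumbbell 0 0) ⊠ A) = (mk invSqrtTwo ⊠ mk (dumbbell 0 0)) ⊠ A from (par_assoc' _ _ _).trans (cast_id _ _ _),
    invSqrtTwo_par_dumbbell, empty_par, cast_id]

/-- `√2 ⊗ 1/√2 ⊗ A = A` for `1 → 2` diagrams. [folklore] -/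
theorem sqrt_two_par_invSqrtTwo_par_one_two (A : ZXClass 1 2) : mk (dumbbell 0 0) ⊠ (mk invSqrtTwo ⊠ A) = A := by
  rw [scalar_par_scalar_par, invSqrtTwo_par_sqrt_two_par_one_two]

/-- Cancelling a `√2` on `1 → 2` diagrams. [folklore] -/
theorem cancel_sqrt_two_left_one_two {Y Y' : ZXClass 1 2} (h : mk (dumbbell 0 0) ⊠ Y = mk (dumbbell 0 0) ⊠ Y') : Y = Y' := by
  have h' := congrArg (mk invSqrtTwo ⊠ ·) h
  simp only [invSqrtTwo_par_sqrt_two_par_one_two] at h'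
  exact h'

/-- **The triangle with an `H`-edge** (`L₀`): `Z^{(1,2)} ⨾ (X^{(1,2)} ⊗ H) ⨾ (𝕀 ⊗ Z^{(2,1)}) = 1/√2 ⊗ (Z(π/2) ⨾ X^{(1,2)} ⨾ (Z(-π/2) ⊗ Z(π/2)))`.
[cite: JeandelPerdrixVilmart2018, Fig. 1 (EU), (B2)] -/
theorem split_xsplit_hBox_merge :
    mk (Z 1 2 0) ⨟ (mk (X 1 2 0) ⊠ mk hBox) ⨟ (mk (wires 1) ⊠ mk (Z 2 1 0)) = mk invSqrtTwo ⊠ (mk (Z 1 1 2) ⨟ mk (X 1 2 0) ⨟ (mk (Z 1 1 6) ⊠ mk (Z 1 1 2))) := by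
  have hmov : ∀ (t : ZXClass 0 0) (B : ZXClass 1 1), mk (X 1 2 0) ⊠ (t ⊠ B) = t ⊠ (mk (X 1 2 0) ⊠ B) := fun t B => by
    rw [show mk (X 1 2 0) ⊠ (t ⊠ B) = (mk (X 1 2 0) ⊠ t) ⊠ B from (par_assoc' _ _ _).trans (cast_id _ _ _), ← scalar_par_one_two_comm]
    exact (par_assoc _ _ _).trans (cast_id _ _ _)
  -- phases next to the green split / merge
  have hz1 : mk (Z 1 2 0) ⨟ (mk (wires 1) ⊠ mk (Z 1 1 2)) = mk (Z 1 1 2) ⨟ mk (Z 1 2 0) := by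
    rw [Z_seq_Z 1 1 2 le_rfl, add_zero]; exact (Z_seq_par_Z 1 1 1 1 le_rfl 0 2).trans (by rw [zero_add])
  have hz2 : (mk (wires 1) ⊠ mk (Z 1 1 2)) ⨟ mk (Z 2 1 0) = mk (Z 2 1 0) ⨟ mk (Z 1 1 2) := by
    rw [Z_seq_Z 2 1 1 le_rfl, zero_add]; exact (par_Z_seq_Z 1 1 1 1 le_rfl 0 2).trans (by rw [zero_add])
  -- the core, with the `X(π/2)` of the Euler decomposition already turned into a leaf node
  have hcore : mk (Z 1 2 0) ⨟ (mk (X 1 2 0) ⊠ (mk (Z 1 1 2) ⨟ mk (xLeafL 0 (-2)) ⨟ mk (Z 1 1 2))) ⨟ (mk (wires 1) ⊠ mk (Z 2 1 0)) =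
      mk invSqrtTwo ⊠ (mk (Z 1 1 2) ⨟ mk (X 1 2 0) ⨟ (mk (Z 1 1 6) ⊠ mk (Z 1 1 2))) := by
    rw [seq_assoc (mk (Z 1 1 2)) (mk (xLeafL 0 (-2))),
      show mk (X 1 2 0) ⊠ (mk (Z 1 1 2) ⨟ (mk (xLeafL 0 (-2)) ⨟ mk (Z 1 1 2))) =
        (mk (wires 1) ⊠ mk (Z 1 1 2)) ⨟ ((mk (X 1 2 0) ⊠ mk (xLeafL 0 (-2))) ⨟ (mk (wires 2) ⊠ mk (Z 1 1 2))) from by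
          symm; rw [interchange, seq_id, interchange, id_seq],
      ← seq_assoc (mk (Z 1 2 0)), hz1, seq_assoc, seq_assoc, ← wires_par_wires 1 1,
      show (mk (wires 1) ⊠ mk (wires 1)) ⊠ mk (Z 1 1 2) = mk (wires 1) ⊠ (mk (wires 1) ⊠ mk (Z 1 1 2)) from (par_assoc _ _ _).trans (cast_id _ _ _),
      seq_assoc (mk (X 1 2 0) ⊠ mk (xLeafL 0 (-2))) (mk (wires 1) ⊠ (mk (wires 1) ⊠ mk (Z 1 1 2))),
      ← wires_par_seq, hz2, wires_par_seq, ← seq_assoc (mk (X 1 2 0) ⊠ mk (xLeafL 0 (-2))), ← seq_assoc (mk (Z 1 2 0)) _ (mk (wires 1) ⊠ mk (Z 1 1 2)),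
      ← seq_assoc (mk (Z 1 2 0)) (mk (X 1 2 0) ⊠ mk (xLeafL 0 (-2))), hXZP, m_b, m_a, Z_six]
  refine cancel_sqrt_two_left_one_two (cancel_sqrt_two_left_one_two ?_)
  rw [hBox_eq_euler_scalars, hmov, hmov, one_two_seq_scalar_par_three, one_two_seq_scalar_par_three, scalar_par_one_three_seq_two, scalar_par_one_three_seq_two,
    scalar_par_scalar_par (mk (dumbbell 0 0)) (mk (dumbbell 4 (-1))), scalar_par_scalar_par (mk (dumbbell 0 0)) (mk (dumbbell 4 (-1))),
    scalar_par_scalar_par (mk (dumbbell 0 0)) (mk invSqrtTwo), sqrt_two_par_invSqrtTwo_par_one_two,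
    -- the inner `√2` turns `X(π/2)` into a leaf node
    ← scalar_par_one_three_seq_two, ← one_two_seq_scalar_par_three, ← hmov, seq_assoc (mk (Z 1 1 2)) (mk (X 1 1 2)) (mk (Z 1 1 2)), ← seq_scalar_par_one (mk (dumbbell 0 0)) (mk (Z 1 1 2)),
    ← scalar_par_seq_one (mk (dumbbell 0 0)) (mk (X 1 1 2)), sqrt_two_par_X_halfpi, scalar_par_seq_one, seq_scalar_par_one, hmov, one_two_seq_scalar_par_three,
    scalar_par_one_three_seq_two, ← seq_assoc (mk (Z 1 1 2)) (mk (xLeafL 0 (-2))), hcore,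
    scalar_par_scalar_par (mk (dumbbell 4 1)) (mk invSqrtTwo), scalar_par_scalar_par (mk (dumbbell 4 (-1))) (mk invSqrtTwo),
    show ∀ Y : ZXClass 1 2, mk (dumbbell 4 (-1)) ⊠ (mk (dumbbell 4 1) ⊠ Y) = (mk (dumbbell 4 (-1)) ⊠ mk (dumbbell 4 1)) ⊠ Y from fun Y => (par_assoc' _ _ _).trans (cast_id _ _ _),
    dumbbell_four_mul, show (-1 : ZMod 8) + 1 = 0 from by decide, dumbbell_four_zero,
    show ∀ Y : ZXClass 1 2, (mk (dumbbell 0 0) ⊠ mk (dumbbell 0 0)) ⊠ Y = mk (dumbbell 0 0) ⊠ (mk (dumbbell 0 0) ⊠ Y) from fun Y => (par_assoc _ _ _).trans (cast_id _ _ _),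
    scalar_par_scalar_par (mk invSqrtTwo) (mk (dumbbell 0 0)), scalar_par_scalar_par (mk invSqrtTwo) (mk (dumbbell 0 0)), sqrt_two_par_invSqrtTwo_par_one_two]
  where
  hXZP : mk (Z 1 2 0) ⨟ (mk (X 1 2 0) ⊠ mk (xLeafL 0 (-2))) ⨟ (mk (wires 1) ⊠ mk (Z 2 1 0)) = mk invSqrtTwo ⊠ (mk (X 1 2 0) ⨟ (mk (Z 1 1 (-2)) ⊠ mk (wires 1))) := by
    have h := congrArg (mk invSqrtTwo ⊠ ·) (xsplit_seq_Z_phase_par (-2))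
    simp only [invSqrtTwo_par_sqrt_two_par_one_two] at h
    exact h.symm
  Z_six : mk invSqrtTwo ⊠ (mk (Z 1 1 2) ⨟ ((mk (X 1 2 0) ⨟ (mk (Z 1 1 (-2)) ⊠ mk (wires 1))) ⨟ (mk (wires 1) ⊠ mk (Z 1 1 2)))) =
      mk invSqrtTwo ⊠ (mk (Z 1 1 2) ⨟ mk (X 1 2 0) ⨟ (mk (Z 1 1 6) ⊠ mk (Z 1 1 2))) := by
    rw [seq_assoc (mk (X 1 2 0)), interchange, id_seq, seq_id, ← seq_assoc, show (-2 : ZMod 8) = 6 from rfl]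
  m_a (A : ZXClass 1 1) (s : ZXClass 0 0) (B : ZXClass 1 2) : A ⨟ (s ⊠ B) = s ⊠ (A ⨟ B) := by
    rw [scalar_par_seq_right, empty_par, cast_id]
  m_b (s : ZXClass 0 0) (A : ZXClass 1 2) (B : ZXClass 2 2) : (s ⊠ A) ⨟ B = s ⊠ (A ⨟ B) := by
    rw [scalar_par_seq_left, empty_par, cast_id]
  one_two_seq_scalar_par_three (A : ZXClass 1 2) (s : ZXClass 0 0) (B : ZXClass 2 3) : A ⨟ (s ⊠ B) = s ⊠ (A ⨟ B) := by
    rw [scalar_par_seq_right, empty_par, cast_id]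
  scalar_par_one_three_seq_two (s : ZXClass 0 0) (A : ZXClass 1 3) (B : ZXClass 3 2) : (s ⊠ A) ⨟ B = s ⊠ (A ⨟ B) := by
    rw [scalar_par_seq_left, empty_par, cast_id]
  scalar_par_seq_two (s : ZXClass 0 0) (A : ZXClass 1 3) (B : ZXClass 3 2) : (s ⊠ A) ⨟ B = s ⊠ (A ⨟ B) := by
    rw [scalar_par_seq_left, empty_par, cast_id]

/-- Cancelling a `db 4 a` on `1 → 2` diagrams. [folklore] -/
theorem cancel_dumbbell_four_one_two (a : ZMod 8) {A B : ZXClass 1 2}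
    (h : mk (dumbbell 4 a) ⊠ A = mk (dumbbell 4 a) ⊠ B) : A = B := by
  have h' : mk (dumbbell 4 (-a)) ⊠ (mk (dumbbell 4 a) ⊠ A) = mk (dumbbell 4 (-a)) ⊠ (mk (dumbbell 4 a) ⊠ B) := by rw [h]
  have e : ∀ C : ZXClass 1 2, mk (dumbbell 4 (-a)) ⊠ (mk (dumbbell 4 a) ⊠ C) = mk (dumbbell 0 0) ⊠ (mk (dumbbell 0 0) ⊠ C) := by
    intro C
    rw [show mk (dumbbell 4 (-a)) ⊠ (mk (dumbbell 4 a) ⊠ C) = (mk (dumbbell 4 (-a)) ⊠ mk (dumbbell 4 a)) ⊠ C from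
        (par_assoc' _ _ _).trans (cast_id _ _ _), dumbbell_four_mul, neg_add_cancel, dumbbell_four_zero]
    exact (par_assoc _ _ _).trans (cast_id _ _ _)
  rw [e, e] at h'
  exact cancel_sqrt_two_left_one_two (cancel_sqrt_two_left_one_two h')

/-- A red phase on the first output of a red split fuses: `X^{(1,2)} ⨾ (X(b) ⊗ 𝕀) = X^{(1,2)}(b)`. [cite: JeandelPerdrixVilmart2018, Fig. 1 (S1)] -/
theorem xsplit_seq_xphase_par (b : ZMod 8) : mk (X 1 2 0) ⨟ (mk (X 1 1 b) ⊠ mk (wires 1)) = mk (X 1 2 b) := by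
  rw [← X_seq_swap 1 0, seq_assoc, swap_seq_par_one_one, ← seq_assoc, X_seq_par_X 1 1 1 1 le_rfl, zero_add]
  exact X_seq_swap 1 b

/-- The common core of the two sides of `xsplit_par_Z_halfpi_hBox`: `Z(π) ⨾ X(π) ⨾ X^{(1,2)} ⨾ (Z(π/2) ⊗ Z(π/2))`. [cite: JeandelPerdrixVilmart2018, Appendix (proof figures)] -/
private theorem xpisplit_seq_Z_six_par_Z_six :
    mk (X 1 2 4) ⨟ (mk (Z 1 1 6) ⊠ mk (Z 1 1 6)) = mk (X 1 1 4) ⨟ mk (Z 1 1 4) ⨟ mk (X 1 2 0) ⨟ (mk (Z 1 1 2) ⊠ mk (Z 1 1 2)) := by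
  rw [show mk (X 1 2 4) = mk (X 1 1 4) ⨟ mk (X 1 2 0) from by rw [X_seq_X 1 1 2 le_rfl, add_zero],
    show mk (Z 1 1 6) ⊠ mk (Z 1 1 6) = (mk (Z 1 1 4) ⊠ mk (Z 1 1 4)) ⨟ (mk (Z 1 1 2) ⊠ mk (Z 1 1 2)) from by
      rw [interchange, Z_seq_Z 1 1 1 le_rfl]; rfl,
    seq_assoc, ← seq_assoc (mk (X 1 2 0)), ← K1]
  simp only [seq_assoc]

/-- **`X^{(1,2)} ⨾ ((Z(π/2) ⨾ H) ⊗ (Z(π/2) ⨾ H)) = X^{(1,2)} ⨾ (Z(-π/2) ⊗ (Z(π/2) ⨾ X(π)))`** (rule (K) twice and the Euler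
decomposition). [cite: JeandelPerdrixVilmart2018, Fig. 1 (K), (EU)] -/
theorem xsplit_par_Z_halfpi_hBox :
    mk (X 1 2 0) ⨟ ((mk (Z 1 1 2) ⨟ mk hBox) ⊠ (mk (Z 1 1 2) ⨟ mk hBox)) = mk (X 1 2 0) ⨟ (mk (Z 1 1 6) ⊠ (mk (Z 1 1 2) ⨟ mk (X 1 1 4))) := by
  have hRl : ∀ (A B : ZXClass 1 1) (t : ZXClass 0 0), A ⊠ (t ⊠ B) = t ⊠ (A ⊠ B) := fun A B t => by
    rw [show A ⊠ (t ⊠ B) = (A ⊠ t) ⊠ B from (par_assoc' _ _ _).trans (cast_id _ _ _), ← scalar_par_one_comm]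
    exact (par_assoc _ _ _).trans (cast_id _ _ _)
  -- the right-hand side times `db 4 6`
  have hT : mk (dumbbell 4 6) ⊠ (mk (X 1 2 0) ⨟ (mk (Z 1 1 6) ⊠ (mk (Z 1 1 2) ⨟ mk (X 1 1 4)))) =
      mk (dumbbell 4 4) ⊠ (mk (Z 1 1 4) ⨟ mk (X 1 1 4) ⨟ mk (X 1 2 0) ⨟ (mk (Z 1 1 2) ⊠ mk (Z 1 1 2))) := by
    rw [← one_seq_scalar_par_two, ← hRl, show mk (dumbbell 4 6) ⊠ (mk (Z 1 1 2) ⨟ mk (X 1 1 4)) = mk (dumbbell 0 0) ⊠ (mk (X 1 1 4) ⨟ mk (Z 1 1 6)) from by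
        rw [rule_K_red 6]; rfl,
      hRl, one_seq_scalar_par_two, show mk (Z 1 1 6) ⊠ (mk (X 1 1 4) ⨟ mk (Z 1 1 6)) = (mk (wires 1) ⊠ mk (X 1 1 4)) ⨟ (mk (Z 1 1 6) ⊠ mk (Z 1 1 6)) from by
        rw [interchange, id_seq],
      ← seq_assoc, X_seq_par_X 1 1 1 1 le_rfl, show mk (X 1 (1 + 1) (0 + 4)) = mk (X 1 2 4) from rfl, xpisplit_seq_Z_six_par_Z_six,
      ← m_b', ← scalar_par_seq_two, rule_K_red 4, scalar_par_seq_two, m_b', show (-4 : ZMod 8) = 4 from by decide]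
  -- the left-hand side times `db 4 6`
  have hS : mk (dumbbell 4 6) ⊠ (mk (X 1 2 0) ⨟ ((mk (Z 1 1 2) ⨟ mk hBox) ⊠ (mk (Z 1 1 2) ⨟ mk hBox))) =
      mk (dumbbell 4 4) ⊠ (mk (Z 1 1 4) ⨟ mk (X 1 1 4) ⨟ mk (X 1 2 0) ⨟ (mk (Z 1 1 2) ⊠ mk (Z 1 1 2))) := by
    have hZH : mk (Z 1 1 2) ⨟ mk hBox = mk (dumbbell 4 (-1)) ⊠ (mk invSqrtTwo ⊠ (mk (Z 1 1 4) ⨟ (mk (X 1 1 2) ⨟ mk (Z 1 1 2)))) := by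
      rw [hBox_eq_euler_scalars, seq_scalar_par_one, seq_scalar_par_one, seq_assoc (mk (Z 1 1 2)) (mk (X 1 1 2)), ← seq_assoc (mk (Z 1 1 2)) (mk (Z 1 1 2)),
        Z_seq_Z 1 1 1 le_rfl]; rfl
    have hE : mk (X 1 2 0) ⨟ ((mk (Z 1 1 4) ⨟ (mk (X 1 1 2) ⨟ mk (Z 1 1 2))) ⊠ (mk (Z 1 1 4) ⨟ (mk (X 1 1 2) ⨟ mk (Z 1 1 2)))) = mk (Z 1 1 4) ⨟ mk (X 1 1 4) ⨟ mk (X 1 2 0) ⨟ (mk (Z 1 1 2) ⊠ mk (Z 1 1 2)) := by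
      rw [← interchange, ← seq_assoc (mk (X 1 2 0)), ← K1, ← interchange (mk (X 1 1 2)) (mk (Z 1 1 2)) (mk (X 1 1 2)) (mk (Z 1 1 2)),
        seq_assoc (mk (Z 1 1 4)), ← seq_assoc (mk (X 1 2 0)),
        show mk (X 1 2 0) ⨟ (mk (X 1 1 2) ⊠ mk (X 1 1 2)) = mk (X 1 1 4) ⨟ mk (X 1 2 0) from by
          rw [par_eq_seq_left (mk (X 1 1 2)) (mk (X 1 1 2)), ← seq_assoc, xsplit_seq_xphase_par,
            X_seq_par_X 1 1 1 1 le_rfl, show (2 : ZMod 8) + 2 = 4 + 0 from by decide, ← X_seq_X 1 1 2 le_rfl],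
        seq_assoc (mk (X 1 1 4)), ← seq_assoc (mk (Z 1 1 4)), ← seq_assoc (mk (Z 1 1 4) ⨟ mk (X 1 1 4))]
    have hsc : ∀ Y : ZXClass 1 2, mk (dumbbell 4 6) ⊠ (mk (dumbbell 4 (-1)) ⊠ (mk invSqrtTwo ⊠ (mk (dumbbell 4 (-1)) ⊠ (mk invSqrtTwo ⊠ Y)))) = mk (dumbbell 4 4) ⊠ Y := fun Y => by
      rw [scalar_par_scalar_par (mk invSqrtTwo) (mk (dumbbell 4 (-1))),
        show mk (dumbbell 4 (-1)) ⊠ (mk (dumbbell 4 (-1)) ⊠ (mk invSqrtTwo ⊠ (mk invSqrtTwo ⊠ Y))) = (mk (dumbbell 4 (-1)) ⊠ mk (dumbbell 4 (-1))) ⊠ (mk invSqrtTwo ⊠ (mk invSqrtTwo ⊠ Y)) from (par_assoc' _ _ _).trans (cast_id _ _ _),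
        dumbbell_four_mul, show (-1 : ZMod 8) + -1 = -2 from by decide,
        show (mk (dumbbell 4 (-2)) ⊠ mk (dumbbell 0 0)) ⊠ (mk invSqrtTwo ⊠ (mk invSqrtTwo ⊠ Y)) = mk (dumbbell 4 (-2)) ⊠ (mk (dumbbell 0 0) ⊠ (mk invSqrtTwo ⊠ (mk invSqrtTwo ⊠ Y))) from (par_assoc _ _ _).trans (cast_id _ _ _),
        sqrt_two_par_invSqrtTwo_par_one_two,
        show mk (dumbbell 4 6) ⊠ (mk (dumbbell 4 (-2)) ⊠ (mk invSqrtTwo ⊠ Y)) = (mk (dumbbell 4 6) ⊠ mk (dumbbell 4 (-2))) ⊠ (mk invSqrtTwo ⊠ Y) from (par_assoc' _ _ _).trans (cast_id _ _ _),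
        dumbbell_four_mul, show (6 : ZMod 8) + -2 = 4 from by decide,
        show (mk (dumbbell 4 4) ⊠ mk (dumbbell 0 0)) ⊠ (mk invSqrtTwo ⊠ Y) = mk (dumbbell 4 4) ⊠ (mk (dumbbell 0 0) ⊠ (mk invSqrtTwo ⊠ Y)) from (par_assoc _ _ _).trans (cast_id _ _ _),
        sqrt_two_par_invSqrtTwo_par_one_two]
    rw [hZH, scalar_par_one_par_one (mk (dumbbell 4 (-1))) (mk invSqrtTwo ⊠ (mk (Z 1 1 4) ⨟ (mk (X 1 1 2) ⨟ mk (Z 1 1 2)))) (mk (dumbbell 4 (-1)) ⊠ (mk invSqrtTwo ⊠ (mk (Z 1 1 4) ⨟ (mk (X 1 1 2) ⨟ mk (Z 1 1 2))))), scalar_par_one_par_one (mk invSqrtTwo) (mk (Z 1 1 4) ⨟ (mk (X 1 1 2) ⨟ mk (Z 1 1 2))) (mk (dumbbell 4 (-1)) ⊠ (mk invSqrtTwo ⊠ (mk (Z 1 1 4) ⨟ (mk (X 1 1 2) ⨟ mk (Z 1 1 2))))),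
      hRl (mk (Z 1 1 4) ⨟ (mk (X 1 1 2) ⨟ mk (Z 1 1 2))) (mk invSqrtTwo ⊠ (mk (Z 1 1 4) ⨟ (mk (X 1 1 2) ⨟ mk (Z 1 1 2)))) (mk (dumbbell 4 (-1))), hRl (mk (Z 1 1 4) ⨟ (mk (X 1 1 2) ⨟ mk (Z 1 1 2))) (mk (Z 1 1 4) ⨟ (mk (X 1 1 2) ⨟ mk (Z 1 1 2))) (mk invSqrtTwo), one_seq_scalar_par_two, one_seq_scalar_par_two, one_seq_scalar_par_two, one_seq_scalar_par_two, hE, hsc]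
  exact cancel_dumbbell_four_one_two 6 (hS.trans hT.symm)
  where
  scalar_par_seq_two (s : ZXClass 0 0) (A : ZXClass 1 1) (B : ZXClass 1 2) : (s ⊠ A) ⨟ B = s ⊠ (A ⨟ B) := by
    rw [scalar_par_seq_left, empty_par, cast_id]
  scalar_par_seq_left' (s : ZXClass 0 0) (A : ZXClass 1 1) (B : ZXClass 1 1) : (s ⊠ A) ⨟ B = s ⊠ (A ⨟ B) := by
    rw [scalar_par_seq_left, empty_par, cast_id]
  one_seq_scalar_par_two (A : ZXClass 1 2) (s : ZXClass 0 0) (B : ZXClass 2 2) : A ⨟ (s ⊠ B) = s ⊠ (A ⨟ B) := by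
    rw [scalar_par_seq_right, empty_par, cast_id]
  m_b' (s : ZXClass 0 0) (A : ZXClass 1 2) (B : ZXClass 2 2) : (s ⊠ A) ⨟ B = s ⊠ (A ⨟ B) := by
    rw [scalar_par_seq_left, empty_par, cast_id]

/-- **The `π`-red-split triangle is the hedge** (JPV LICS 2019, steps D6–D8 of `control-alpha-with-triangles`):
`Z^{(1,2)} ⨾ (X^{(1,2)}(π) ⊗ H) ⨾ (𝕀 ⊗ Z^{(2,1)}) = X^{(1,2)}(π) ⨾ (Z^{(1,2)} ⊗ Z^{(1,2)}) ⨾ (𝕀 ⊗ H∪ᵗ ⊗ 𝕀)`.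
[cite: JeandelPerdrixVilmart2018, Fig. 1 (B2), (EU), (K)] -/
theorem split_xpisplit_hBox_merge :
    mk (Z 1 2 0) ⨟ (mk (X 1 2 4) ⊠ mk hBox) ⨟ (mk (wires 1) ⊠ mk (Z 2 1 0)) = mk (X 1 2 4) ⨟ (mk (Z 1 2 0) ⊠ mk (Z 1 2 0)) ⨟ ((mk (wires 1) ⊠ ((mk hBox ⊠ mk (wires 1)) ⨟ mk cap)) ⊠ mk (wires 1)) := by
  have hHH : (mk hBox ⊠ mk hBox) ⨟ (mk hBox ⊠ mk hBox) = mk (wires 2) := by rw [interchange, hBox_seq_hBox, wires_par_wires]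
  have hHZ : mk hBox ⨟ mk (Z 1 2 0) = mk (X 1 2 0) ⨟ (mk hBox ⊠ mk hBox) := by
    rw [X_split_eq 0, seq_assoc, seq_assoc, hHH, seq_id]
  -- the left-hand side: `Z(π) ⨾ L₀ ⨾ (𝕀 ⊗ X(π))`
  have hL : mk (Z 1 2 0) ⨟ (mk (X 1 2 4) ⊠ mk hBox) ⨟ (mk (wires 1) ⊠ mk (Z 2 1 0)) = mk invSqrtTwo ⊠ (mk (Z 1 1 6) ⨟ mk (X 1 2 0) ⨟ (mk (Z 1 1 6) ⊠ (mk (Z 1 1 2) ⨟ mk (X 1 1 4)))) := by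
    rw [show mk (X 1 2 4) = mk (X 1 2 0) ⨟ (mk (wires 1) ⊠ mk (X 1 1 4)) from by rw [X_seq_par_X 1 1 1 1 le_rfl, zero_add],
      show (mk (X 1 2 0) ⨟ (mk (wires 1) ⊠ mk (X 1 1 4))) ⊠ mk hBox = (mk (X 1 2 0) ⊠ mk hBox) ⨟ ((mk (wires 1) ⊠ mk (X 1 1 4)) ⊠ mk (wires 1)) from by
        rw [interchange, seq_id],
      seq_assoc, seq_assoc, show (mk (wires 1) ⊠ mk (X 1 1 4)) ⊠ mk (wires 1) = mk (wires 1) ⊠ (mk (X 1 1 4) ⊠ mk (wires 1)) from (par_assoc _ _ _).trans (cast_id _ _ _),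
      ← wires_par_seq, X_pi_par_seq_Z_merge, wires_par_seq, wires_par_seq, ← seq_assoc (mk (X 1 2 0) ⊠ mk hBox), ← seq_assoc (mk (X 1 2 0) ⊠ mk hBox),
      show (mk (X 1 2 0) ⊠ mk hBox) ⨟ (mk (wires 1) ⊠ (mk (wires 1) ⊠ mk (X 1 1 4))) = (mk (wires 1) ⊠ mk (Z 1 1 4)) ⨟ (mk (X 1 2 0) ⊠ mk hBox) from by
        rw [show mk (wires 1) ⊠ (mk (wires 1) ⊠ mk (X 1 1 4)) = mk (wires 2) ⊠ mk (X 1 1 4) from by rw [← wires_par_wires 1 1]; exact (par_assoc' _ _ _).trans (cast_id _ _ _),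
          interchange, seq_id, ← Z_phase_seq_hBox, show mk (X 1 2 0) ⊠ (mk (Z 1 1 4) ⨟ mk hBox) = (mk (wires 1) ⊠ mk (Z 1 1 4)) ⨟ (mk (X 1 2 0) ⊠ mk hBox) from by
            rw [interchange, id_seq]],
      seq_assoc (mk (wires 1) ⊠ mk (Z 1 1 4)) (mk (X 1 2 0) ⊠ mk hBox) (mk (wires 1) ⊠ mk (Z 2 1 0)), ← seq_assoc (mk (Z 1 2 0)) _ (mk (wires 1) ⊠ mk (X 1 1 4)),
      ← seq_assoc (mk (Z 1 2 0)) (mk (wires 1) ⊠ mk (Z 1 1 4)),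
      show mk (Z 1 2 0) ⨟ (mk (wires 1) ⊠ mk (Z 1 1 4)) = mk (Z 1 1 4) ⨟ mk (Z 1 2 0) from by
        rw [Z_seq_Z 1 1 2 le_rfl, add_zero]; exact (Z_seq_par_Z 1 1 1 1 le_rfl 0 4).trans (by rw [zero_add]),
      seq_assoc (mk (Z 1 1 4)) (mk (Z 1 2 0)), ← seq_assoc (mk (Z 1 2 0)) (mk (X 1 2 0) ⊠ mk hBox), split_xsplit_hBox_merge, one_seq_scalar_par_two', m_b',
      ← seq_assoc (mk (Z 1 1 4)) (mk (Z 1 1 2) ⨟ mk (X 1 2 0)), ← seq_assoc (mk (Z 1 1 4)) (mk (Z 1 1 2)), Z_seq_Z 1 1 1 le_rfl, show (4 : ZMod 8) + 2 = 6 from rfl,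
      seq_assoc _ (mk (Z 1 1 6) ⊠ mk (Z 1 1 2)), interchange, seq_id]
  -- the right-hand side through `L10ᵀ`
  have h10T : mk (Z 1 2 0) ⨟ (mk (X 1 1 2) ⊠ mk (X 1 1 2)) =
      mk (dumbbell 0 0) ⊠ (mk (X 1 1 2) ⨟ (mk (Z 1 2 4) ⨟ ((mk (wires 1) ⊠ mk hBox) ⨟ ((mk (wires 1) ⊠ mk (Z 1 2 0)) ⨟ (((mk hBox ⊠ mk hBox) ⨟ mk (Z 2 1 0)) ⊠ mk (wires 1)))))) := by
    have h := congrArg transpose X_halfpis_seq_Z_merge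
    simpa using h
  have hC : ((mk (wires 1) ⊠ mk (Z 1 2 0)) ⨟ (((mk hBox ⊠ mk hBox) ⨟ mk (Z 2 1 0)) ⊠ mk (wires 1))) = (mk hBox ⊠ mk (wires 1)) ⨟ (mk (Z 1 2 0) ⊠ mk (Z 1 2 0)) ⨟ ((mk (wires 1) ⊠ ((mk hBox ⊠ mk (wires 1)) ⨟ mk cap)) ⊠ mk (wires 1)) := by
    rw [← hBox_par_split_hBox_seq_merge, seq_par_wires, ← seq_assoc,
      show (mk hBox ⊠ mk hBox) ⊠ mk (wires 1) = mk hBox ⊠ (mk hBox ⊠ mk (wires 1)) from (par_assoc _ _ _).trans (cast_id _ _ _), interchange, id_seq]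
  have hcore : mk (Z 1 2 4) ⨟ ((mk (wires 1) ⊠ mk hBox) ⨟ ((mk (wires 1) ⊠ mk (Z 1 2 0)) ⨟ (((mk hBox ⊠ mk hBox) ⨟ mk (Z 2 1 0)) ⊠ mk (wires 1)))) = mk invSqrtTwo ⊠ (mk (X 1 1 6) ⨟ mk (Z 1 2 0) ⨟ (mk (X 1 1 2) ⊠ mk (X 1 1 2))) := by
    have h := congrArg (fun Y => mk invSqrtTwo ⊠ (mk (X 1 1 6) ⨟ Y)) h10T
    simp only [seq_scalar_par_one_two, invSqrtTwo_par_sqrt_two_par_one_two] at h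
    rw [← seq_assoc (mk (X 1 1 6)) (mk (X 1 1 2)), xphase_seq_xphase, show (6 : ZMod 8) + 2 = 0 from by decide, X_one_one, id_seq] at h
    rw [← h, ← seq_assoc]
  have hR : mk (X 1 2 4) ⨟ (mk (Z 1 2 0) ⊠ mk (Z 1 2 0)) ⨟ ((mk (wires 1) ⊠ ((mk hBox ⊠ mk (wires 1)) ⨟ mk cap)) ⊠ mk (wires 1)) = mk invSqrtTwo ⊠ (mk hBox ⨟ mk (X 1 1 6) ⨟ mk (Z 1 2 0) ⨟ (mk (X 1 1 2) ⊠ mk (X 1 1 2))) := by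
    rw [X_split_eq 4, show mk (Z 1 2 4) = mk (Z 1 2 4) from rfl, seq_assoc, seq_assoc, seq_assoc, ← seq_assoc (mk hBox ⊠ mk hBox) (mk (Z 1 2 0) ⊠ mk (Z 1 2 0)),
      show mk hBox ⊠ mk hBox = (mk (wires 1) ⊠ mk hBox) ⨟ (mk hBox ⊠ mk (wires 1)) from by rw [← par_eq_seq_right],
      seq_assoc (mk (wires 1) ⊠ mk hBox), seq_assoc (mk (wires 1) ⊠ mk hBox), ← hC, hcore,
      seq_scalar_par_one_two, ← seq_assoc, ← seq_assoc]
  rw [hL, hR]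
  simp only [seq_assoc]
  rw [← seq_assoc (mk hBox) (mk (X 1 1 6)), ← Z_phase_seq_hBox, seq_assoc (mk (Z 1 1 6)) (mk hBox), ← seq_assoc (mk hBox) (mk (Z 1 2 0)), hHZ,
    seq_assoc (mk (X 1 2 0)) (mk hBox ⊠ mk hBox), interchange, ← Z_phase_seq_hBox, xsplit_par_Z_halfpi_hBox]
  where
  m_b' (s : ZXClass 0 0) (A : ZXClass 1 2) (B : ZXClass 2 2) : (s ⊠ A) ⨟ B = s ⊠ (A ⨟ B) := by
    rw [scalar_par_seq_left, empty_par, cast_id]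
  one_seq_scalar_par_two' (A : ZXClass 1 1) (s : ZXClass 0 0) (B : ZXClass 1 2) : A ⨟ (s ⊠ B) = s ⊠ (A ⨟ B) := by
    rw [scalar_par_seq_right, empty_par, cast_id]
  seq_scalar_par_one_two (A : ZXClass 1 1) (s : ZXClass 0 0) (B : ZXClass 1 2) : A ⨟ (s ⊠ B) = s ⊠ (A ⨟ B) := by
    rw [scalar_par_seq_right, empty_par, cast_id]

/-! ### Scalar movers for the arities used below -/

/-- Bookkeeping mover (scalars / associativity of `⊗`). [cite: JeandelPerdrixVilmart2018, §2.2 (only topology matters; scalars)] -/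
private theorem mv_a (A : ZXClass 1 2) (s : ZXClass 0 0) (B : ZXClass 2 2) : A ⨟ (s ⊠ B) = s ⊠ (A ⨟ B) := by
  rw [scalar_par_seq_right, empty_par, cast_id]
/-- Bookkeeping mover (scalars / associativity of `⊗`). [cite: JeandelPerdrixVilmart2018, §2.2 (only topology matters; scalars)] -/
private theorem mv_b (s : ZXClass 0 0) (A : ZXClass 1 2) (B : ZXClass 2 2) : (s ⊠ A) ⨟ B = s ⊠ (A ⨟ B) := by
  rw [scalar_par_seq_left, empty_par, cast_id]
/-- Bookkeeping mover (scalars / associativity of `⊗`). [cite: JeandelPerdrixVilmart2018, §2.2 (only topology matters; scalars)] -/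
private theorem mv_c (A : ZXClass 1 1) (s : ZXClass 0 0) (B : ZXClass 1 2) : A ⨟ (s ⊠ B) = s ⊠ (A ⨟ B) := by
  rw [scalar_par_seq_right, empty_par, cast_id]
/-- Bookkeeping mover (scalars / associativity of `⊗`). [cite: JeandelPerdrixVilmart2018, §2.2 (only topology matters; scalars)] -/
private theorem mv_d (s : ZXClass 0 0) (A : ZXClass 1 1) (B : ZXClass 1 2) : (s ⊠ A) ⨟ B = s ⊠ (A ⨟ B) := by
  rw [scalar_par_seq_left, empty_par, cast_id]
/-- Bookkeeping mover (scalars / associativity of `⊗`). [cite: JeandelPerdrixVilmart2018, §2.2 (only topology matters; scalars)] -/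
private theorem mv_e (A : ZXClass 1 1) (s : ZXClass 0 0) (B : ZXClass 1 0) : A ⨟ (s ⊠ B) = s ⊠ (A ⨟ B) := by
  rw [scalar_par_seq_right, empty_par, cast_id]
/-- Bookkeeping mover (scalars / associativity of `⊗`). [cite: JeandelPerdrixVilmart2018, §2.2 (only topology matters; scalars)] -/
private theorem mv_f (s : ZXClass 0 0) (A : ZXClass 1 0) (B : ZXClass 0 1) : (s ⊠ A) ⨟ B = s ⊠ (A ⨟ B) := by
  rw [scalar_par_seq_left, empty_par, cast_id]
/-- Bookkeeping mover (scalars / associativity of `⊗`). [cite: JeandelPerdrixVilmart2018, §2.2 (only topology matters; scalars)] -/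
private theorem hRl' (A B : ZXClass 1 1) (t : ZXClass 0 0) : A ⊠ (t ⊠ B) = t ⊠ (A ⊠ B) := by
  rw [show A ⊠ (t ⊠ B) = (A ⊠ t) ⊠ B from (par_assoc' _ _ _).trans (cast_id _ _ _), ← scalar_par_one_comm]
  exact (par_assoc _ _ _).trans (cast_id _ _ _)

/-- Endgame step 1: the two leaf flips. [cite: JeandelPerdrixVilmart2018, Fig. 1 (K)] -/
private theorem endgame_flips :
    mk (dumbbell 4 (-1)) ⊠ (mk (dumbbell 0 0) ⊠ (mk (X 1 2 4) ⨟ (mk (Z 1 2 (-1)) ⊠ mk (Z 1 2 (-1))) ⨟ ((mk (wires 1) ⊠ ((mk hBox ⊠ mk (wires 1)) ⨟ mk cap)) ⊠ mk (wires 1)) ⨟ (mk (xLeafL 0 1) ⊠ mk (xLeafL 4 1)) ⨟ mk (Z 2 1 0))) =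
      mk (dumbbell 0 0) ⊠ (mk (dumbbell 4 1) ⊠ (mk (X 1 2 4) ⨟ (mk (Z 1 2 (-1)) ⊠ mk (Z 1 2 (-1))) ⨟ ((mk (wires 1) ⊠ ((mk hBox ⊠ mk (wires 1)) ⨟ mk cap)) ⊠ mk (wires 1)) ⨟ (mk (xLeafL 4 (-1)) ⊠ mk (xLeafR 0 (-1))) ⨟ mk (Z 2 1 0))) := by
  have hKl : mk (dumbbell 4 (-1)) ⊠ mk (xLeafL 0 1) = mk (dumbbell 0 0) ⊠ mk (xLeafL 4 (-1)) := by simpa using (dumbbell_four_par_xLeafL_neg 0 (-1))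
  have hKr : mk (dumbbell 0 0) ⊠ mk (xLeafL 4 1) = mk (dumbbell 4 1) ⊠ mk (xLeafL 0 (-1)) := by simpa using (dumbbell_four_par_xLeafL_neg 0 1).symm
  rw [← scalar_par_one_two_seq_one (mk (dumbbell 0 0)), ← mv_a _ (mk (dumbbell 0 0)), ← hRl', hKr, hRl', mv_a, scalar_par_one_two_seq_one,
    scalar_par_scalar_par (mk (dumbbell 4 (-1))) (mk (dumbbell 4 1)), ← scalar_par_one_two_seq_one (mk (dumbbell 4 (-1))), ← mv_a _ (mk (dumbbell 4 (-1))), ← scalar_par_one_par_one, hKl, scalar_par_one_par_one, mv_a,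
    scalar_par_one_two_seq_one, xLeafL_eq_xLeafR 0 (-1), scalar_par_scalar_par]

/-- Endgame step 2: (C1) on the unfolded red `π`-split, fusion and the `H`-loop. [cite: JeandelPerdrixVilmart2018, Appendix Lemma 17] -/
private theorem endgame_c1_loop :
    mk (X 1 2 4) ⨟ (mk (Z 1 2 (-1)) ⊠ mk (Z 1 2 (-1))) ⨟ ((mk (wires 1) ⊠ ((mk hBox ⊠ mk (wires 1)) ⨟ mk cap)) ⊠ mk (wires 1)) ⨟ (mk (xLeafL 4 (-1)) ⊠ mk (xLeafR 0 (-1))) ⨟ mk (Z 2 1 0) =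
      mk invSqrtTwo ⊠ (mk hBox ⨟ mk (Z 1 2 6) ⨟ (mk (xLeafL 0 (-1)) ⊠ mk (xLeafL 4 (-1))) ⨟ mk (Z 2 1 0)) := by
  have hHH : (mk (wires 1) ⊠ mk hBox) ⨟ (mk (wires 1) ⊠ mk hBox) = mk (wires 2) := by rw [← wires_par_seq, hBox_seq_hBox, wires_par_wires]
  rw [X_split_eq 4, par_eq_seq_right (mk hBox) (mk hBox)]
  simp only [seq_assoc]
  rw [← seq_assoc (mk (Z 1 2 (-1)) ⊠ mk (Z 1 2 (-1))) ((mk (wires 1) ⊠ ((mk hBox ⊠ mk (wires 1)) ⨟ mk cap)) ⊠ mk (wires 1)), ← seq_assoc ((mk (Z 1 2 (-1)) ⊠ mk (Z 1 2 (-1))) ⨟ ((mk (wires 1) ⊠ ((mk hBox ⊠ mk (wires 1)) ⨟ mk cap)) ⊠ mk (wires 1))), ← seq_assoc (mk hBox ⊠ mk (wires 1)), ← seq_assoc (mk hBox ⊠ mk (wires 1)),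
    ← seq_assoc (mk hBox ⊠ mk (wires 1)) (mk (Z 1 2 (-1)) ⊠ mk (Z 1 2 (-1))) ((mk (wires 1) ⊠ ((mk hBox ⊠ mk (wires 1)) ⨟ mk cap)) ⊠ mk (wires 1)), c1Gadget_eq_mirror]
  simp only [seq_assoc]
  rw [← seq_assoc (mk (wires 1) ⊠ mk hBox) (mk (wires 1) ⊠ mk hBox), hHH, id_seq,
    par_eq_seq_left (mk (Z 1 2 (-1))) (mk (Z 1 2 (-1))), seq_assoc (mk (Z 1 2 (-1)) ⊠ mk (wires 1)), ← seq_assoc (mk (Z 1 2 4)) (mk (Z 1 2 (-1)) ⊠ mk (wires 1)),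
    Z_seq_Z_par 1 1 1 2 le_rfl, show (-1 : ZMod 8) + 4 = 3 from by decide, ← seq_assoc (mk (Z 1 3 3)), Z_seq_par_Z 1 2 1 2 le_rfl, show (3 : ZMod 8) + -1 = 2 from by decide,
    show mk (Z 1 4 2) = mk (Z 1 2 2) ⨟ (mk (Z 1 3 0) ⊠ mk (wires 1)) from by rw [Z_seq_Z_par 1 1 1 3 le_rfl, zero_add],
    seq_assoc (mk (Z 1 2 2)), ← seq_assoc (mk (Z 1 3 0) ⊠ mk (wires 1)) ((mk (wires 1) ⊠ ((mk hBox ⊠ mk (wires 1)) ⨟ mk cap)) ⊠ mk (wires 1)), ← seq_par_wires, hLoop_div, scalar_par_one_par_one, scalar_par_two_two_seq_one,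
    one_two_seq_scalar_par_one, ← seq_assoc (mk (Z 1 2 2)) (mk (Z 1 1 4) ⊠ mk (wires 1)), Z_seq_Z_par 1 1 1 1 le_rfl, show (4 : ZMod 8) + 2 = 6 from rfl,
    seq_scalar_par_one, ← xLeafL_eq_xLeafR 4 (-1)]
  where
  hLoop_div : mk (Z 1 3 0) ⨟ (mk (wires 1) ⊠ ((mk hBox ⊠ mk (wires 1)) ⨟ mk cap)) = mk invSqrtTwo ⊠ mk (Z 1 1 4) := by
    have h := congrArg (mk invSqrtTwo ⊠ ·) sqrt_two_par_hLoop
    rw [invSqrtTwo_par_sqrt_two_par_one] at h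
    exact h

/-- `xLeafL 0 0` disconnects: `xLeafL 0 0 = 1/√2 ⊗ (Z^{(1,0)} ⨾ Z^{(0,1)})`. [cite: JeandelPerdrixVilmart2018, Fig. 1 (B1)] -/
theorem xLeafL_zero_zero : mk (xLeafL 0 0) = mk invSqrtTwo ⊠ (mk (Z 1 0 0) ⨟ mk (Z 0 1 0)) := by
  have h := congrArg (mk invSqrtTwo ⊠ ·) sqrt_two_par_state_par_X_merge
  rw [invSqrtTwo_par_sqrt_two_par_one, Z_state_par_seq_X_merge] at h
  exact h

/-- Endgame step 3: the leafy four-cycle and the disconnection. [cite: JeandelPerdrixVilmart2018, Fig. 1 (B2), (B1)] -/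
private theorem endgame_leafy :
    mk (dumbbell 0 0) ⊠ (mk hBox ⨟ mk (Z 1 2 6) ⨟ (mk (xLeafL 0 (-1)) ⊠ mk (xLeafL 4 (-1))) ⨟ mk (Z 2 1 0)) =
      mk (dumbbell 4 (-1)) ⊠ (mk invSqrtTwo ⊠ (mk invSqrtTwo ⊠ (mk (X 1 0 6) ⨟ mk (Z 0 1 0)))) := by
  have hKr' : mk (dumbbell 0 0) ⊠ mk (xLeafL 4 (-1)) = mk (dumbbell 4 (-1)) ⊠ mk (xLeafL 0 1) := by simpa using (dumbbell_four_par_xLeafL_neg 0 (-1)).symm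
  have hQ : mk (Z 1 2 0) ⨟ (mk (xLeafL 0 (-1)) ⊠ mk (xLeafL 0 1)) ⨟ mk (Z 2 1 0) = mk invSqrtTwo ⊠ mk (xLeafL 0 0) := by
    have h := congrArg (mk invSqrtTwo ⊠ ·) (leafy_four_cycle (-1) 1)
    rw [invSqrtTwo_par_sqrt_two_par_one, show (-1 : ZMod 8) + 1 = 0 from by decide] at h
    exact h
  rw [← scalar_par_one_two_seq_one (mk (dumbbell 0 0)), ← mv_a _ (mk (dumbbell 0 0)), ← hRl', hKr', hRl', mv_a, scalar_par_one_two_seq_one,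
    seq_assoc (mk hBox) (mk (Z 1 2 6)), show mk (Z 1 2 6) = mk (Z 1 1 6) ⨟ mk (Z 1 2 0) from by rw [Z_seq_Z 1 1 2 le_rfl, add_zero],
    seq_assoc (mk (Z 1 1 6)) (mk (Z 1 2 0)), seq_assoc (mk hBox) _ (mk (Z 2 1 0)), seq_assoc (mk (Z 1 1 6)) _ (mk (Z 2 1 0)), seq_assoc (mk (Z 1 2 0)) _ (mk (Z 2 1 0)),
    ← seq_assoc (mk (Z 1 2 0)) (mk (xLeafL 0 (-1)) ⊠ mk (xLeafL 0 1)) (mk (Z 2 1 0)), hQ, xLeafL_zero_zero, seq_scalar_par_one, seq_scalar_par_one,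
    seq_scalar_par_one, seq_scalar_par_one, ← seq_assoc (mk (Z 1 1 6)) (mk (Z 1 0 0)) (mk (Z 0 1 0)), Z_seq_Z 1 1 0 le_rfl, add_zero,
    ← seq_assoc (mk hBox) (mk (Z 1 0 6)) (mk (Z 0 1 0)), ← X_effect_eq]

/-- **The `π`-red-split (C1) gadget evaluates to a disconnection** (endgame of `control-alpha-with-triangles`):
`X^{(1,2)}(π) ⨾ (Z^{(1,2)}(-π/4) ⊗ Z^{(1,2)}(-π/4)) ⨾ hedge ⨾ (xLeafL 0 (π/4) ⊗ xLeafL π (π/4)) ⨾ Z^{(2,1)} = (1/√2)³ ⊗ (Z^{(1,0)}(π/2) ⨾ Z^{(0,1)})`.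
[cite: JeandelPerdrixVilmart2018, Appendix Lemma 17 (C1); JPV LICS 2019 Appendix] -/
theorem xpisplit_czLeaves_merge :
    mk (X 1 2 4) ⨟ (mk (Z 1 2 (-1)) ⊠ mk (Z 1 2 (-1))) ⨟ ((mk (wires 1) ⊠ ((mk hBox ⊠ mk (wires 1)) ⨟ mk cap)) ⊠ mk (wires 1)) ⨟ (mk (xLeafL 0 1) ⊠ mk (xLeafL 4 1)) ⨟ mk (Z 2 1 0) =
      mk invSqrtTwo ⊠ (mk invSqrtTwo ⊠ (mk invSqrtTwo ⊠ (mk (Z 1 0 2) ⨟ mk (Z 0 1 0)))) := by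
  refine cancel_sqrt_two_left (cancel_dumbbell_four_one_one (-1) ?_)
  rw [endgame_flips, endgame_c1_loop, scalar_par_scalar_par (mk (dumbbell 4 1)) (mk invSqrtTwo), scalar_par_scalar_par (mk (dumbbell 0 0)) (mk invSqrtTwo),
    scalar_par_scalar_par (mk (dumbbell 0 0)) (mk (dumbbell 4 1)), endgame_leafy, sqrt_two_par_invSqrtTwo_par_one, Z_effect_two_eq, show (-2 : ZMod 8) = 6 from rfl, mv_f, mv_f]
  simp only [scalar_par_scalar_par (mk invSqrtTwo) (mk (dumbbell 4 1)), scalar_par_scalar_par (mk invSqrtTwo) (mk (dumbbell 4 (-1))),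
    scalar_par_scalar_par (mk (dumbbell 4 1)) (mk (dumbbell 4 (-1)))]

/-- `1/√2 ⊗ √2 ⊗ A = A` for `2 → 1` diagrams. [folklore] -/
theorem invSqrtTwo_par_sqrt_two_par_two_one (A : ZXClass 2 1) : mk invSqrtTwo ⊠ (mk (dumbbell 0 0) ⊠ A) = A := by
  rw [show mk invSqrtTwo ⊠ (mk (dumbbell 0 0) ⊠ A) = (mk invSqrtTwo ⊠ mk (dumbbell 0 0)) ⊠ A from (par_assoc' _ _ _).trans (cast_id _ _ _),
    invSqrtTwo_par_dumbbell, empty_par, cast_id]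

/-- A merge with an `H` on its first input, as a split bent by the `H`-cap:
`(H ⊗ 𝕀) ⨾ Z^{(2,1)}(b) = (𝕀 ⊗ Z^{(1,2)}(b)) ⨾ (H∪ᵗ ⊗ 𝕀)`. [cite: JeandelPerdrixVilmart2018, §2.2] -/
theorem hBox_par_seq_Z_merge_eq_bent (b : ZMod 8) :
    (mk hBox ⊠ mk (wires 1)) ⨟ mk (Z 2 1 b) = (mk (wires 1) ⊠ mk (Z 1 2 b)) ⨟ (((mk hBox ⊠ mk (wires 1)) ⨟ mk cap) ⊠ mk (wires 1)) := by
  have hbend : (mk (wires 1) ⊠ mk (Z 1 2 0)) ⨟ (mk cap ⊠ mk (wires 1)) = mk (Z 2 1 0) := by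
    have h := congrArg colorSwap par_xsplit_seq_cap_par
    simpa using h
  rw [seq_par_wires, ← seq_assoc, show (mk hBox ⊠ mk (wires 1)) ⊠ mk (wires 1) = mk hBox ⊠ mk (wires 2) from by rw [← wires_par_wires 1 1]; exact (par_assoc _ _ _).trans (cast_id _ _ _),
    show (mk (wires 1) ⊠ mk (Z 1 2 b)) ⨟ (mk hBox ⊠ mk (wires 2)) = (mk hBox ⊠ mk (wires 1)) ⨟ (mk (wires 1) ⊠ mk (Z 1 2 b)) from by
      rw [interchange, id_seq, seq_id, ← par_eq_seq_left],
    show mk (Z 1 2 b) = mk (Z 1 2 0) ⨟ (mk (wires 1) ⊠ mk (Z 1 1 b)) from by rw [Z_seq_par_Z 1 1 1 1 le_rfl, zero_add],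
    wires_par_seq, seq_assoc, seq_assoc, show mk (wires 1) ⊠ (mk (wires 1) ⊠ mk (Z 1 1 b)) = mk (wires 2) ⊠ mk (Z 1 1 b) from by
      rw [← wires_par_wires 1 1]; exact (par_assoc' _ _ _).trans (cast_id _ _ _),
    show (mk (wires 2) ⊠ mk (Z 1 1 b)) ⨟ (mk cap ⊠ mk (wires 1)) = (mk cap ⊠ mk (wires 1)) ⨟ mk (Z 1 1 b) from by
      rw [interchange, id_seq, seq_id, par_eq_seq_left (mk cap) (mk (Z 1 1 b)), empty_par, cast_id],
    ← seq_assoc (mk (wires 1) ⊠ mk (Z 1 2 0)), hbend, Z_seq_Z 2 1 1 le_rfl, show (0 : ZMod 8) + b = b from zero_add b]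

/-- **The first (C1) of `control-alpha-with-triangles` as a block identity**: with `blk(α) = (Z^{(1,2)}(α) ⊗ 𝕀) ⨾
(xLeafL 0 (-α) ⊗ ((H ⊗ 𝕀) ⨾ Z^{(2,1)}(-π/4) ⨾ xLeafL π (π/4))) ⨾ Z^{(2,1)}`,
`db 4 α ⊗ blk(α) = db 4 1 ⊗ ((H ⊗ H) ⨾ (Z^{(1,2)}(-π/4) ⊗ Z^{(1,2)}(α)) ⨾ hedge ⨾ (xLeafL 0 (-π/4) ⊗ xLeafL π α) ⨾ Z^{(2,1)})`.
[cite: JeandelPerdrixVilmart2018, Appendix Lemma 17 (C1), Fig. 1 (K)] -/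
theorem c1_block (a : ZMod 8) :
    mk (dumbbell 4 a) ⊠ ((mk (Z 1 2 a) ⊠ mk (wires 1)) ⨟ (mk (xLeafL 0 (-a)) ⊠ ((mk hBox ⊠ mk (wires 1)) ⨟ mk (Z 2 1 (-1)) ⨟ mk (xLeafL 4 1))) ⨟ mk (Z 2 1 0)) =
      mk (dumbbell 4 1) ⊠ ((mk hBox ⊠ mk hBox) ⨟ (mk (Z 1 2 (-1)) ⊠ mk (Z 1 2 a)) ⨟ ((mk (wires 1) ⊠ ((mk hBox ⊠ mk (wires 1)) ⨟ mk cap)) ⊠ mk (wires 1)) ⨟ (mk (xLeafL 0 (-1)) ⊠ mk (xLeafL 4 a)) ⨟ mk (Z 2 1 0)) := by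
  have hKl : mk (dumbbell 4 a) ⊠ mk (xLeafL 0 (-a)) = mk (dumbbell 0 0) ⊠ mk (xLeafL 4 a) := by simpa using (dumbbell_four_par_xLeafL_neg 0 a)
  have hKr : mk (dumbbell 0 0) ⊠ mk (xLeafL 4 1) = mk (dumbbell 4 1) ⊠ mk (xLeafL 0 (-1)) := by simpa using (dumbbell_four_par_xLeafL_neg 0 1).symm
  -- the structure: the merge with its `H` is the second split bent by the hedge
  have hS : (mk (Z 1 2 a) ⊠ mk (wires 1)) ⨟ (mk (xLeafL 4 a) ⊠ ((mk hBox ⊠ mk (wires 1)) ⨟ mk (Z 2 1 (-1)) ⨟ mk (xLeafR 0 (-1)))) ⨟ mk (Z 2 1 0) =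
      (mk (Z 1 2 a) ⊠ mk (Z 1 2 (-1))) ⨟ ((mk (wires 1) ⊠ ((mk hBox ⊠ mk (wires 1)) ⨟ mk cap)) ⊠ mk (wires 1)) ⨟ (mk (xLeafL 4 a) ⊠ mk (xLeafR 0 (-1))) ⨟ mk (Z 2 1 0) := by
    rw [par_eq_seq_right (mk (xLeafL 4 a)) ((mk hBox ⊠ mk (wires 1)) ⨟ mk (Z 2 1 (-1)) ⨟ mk (xLeafR 0 (-1))), wires_par_seq, hBox_par_seq_Z_merge_eq_bent, wires_par_seq,
      show mk (wires 1) ⊠ (mk (wires 1) ⊠ mk (Z 1 2 (-1))) = mk (wires 2) ⊠ mk (Z 1 2 (-1)) from by rw [← wires_par_wires 1 1]; exact (par_assoc' _ _ _).trans (cast_id _ _ _),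
      show mk (wires 1) ⊠ (((mk hBox ⊠ mk (wires 1)) ⨟ mk cap) ⊠ mk (wires 1)) = ((mk (wires 1) ⊠ ((mk hBox ⊠ mk (wires 1)) ⨟ mk cap)) ⊠ mk (wires 1)) from (par_assoc' _ _ _).trans (cast_id _ _ _),
      seq_assoc (mk (wires 2) ⊠ mk (Z 1 2 (-1))), seq_assoc (mk (wires 2) ⊠ mk (Z 1 2 (-1))),
      ← seq_assoc (mk (Z 1 2 a) ⊠ mk (wires 1)) (mk (wires 2) ⊠ mk (Z 1 2 (-1))), ← par_eq_seq_left,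
      seq_assoc ((mk (wires 1) ⊠ ((mk hBox ⊠ mk (wires 1)) ⨟ mk cap)) ⊠ mk (wires 1)) (mk (wires 1) ⊠ mk (xLeafR 0 (-1))), show (mk (wires 1) ⊠ mk (xLeafR 0 (-1))) ⨟ (mk (xLeafL 4 a) ⊠ mk (wires 1)) = mk (xLeafL 4 a) ⊠ mk (xLeafR 0 (-1)) from by
        rw [interchange, id_seq, seq_id],
      ← seq_assoc]
  refine cancel_sqrt_two_two_one ?_
  rw [← scalar_par_two_two_seq_one (mk (dumbbell 4 a)),
    show mk (dumbbell 4 a) ⊠ ((mk (Z 1 2 a) ⊠ mk (wires 1)) ⨟ (mk (xLeafL 0 (-a)) ⊠ ((mk hBox ⊠ mk (wires 1)) ⨟ mk (Z 2 1 (-1)) ⨟ mk (xLeafL 4 1)))) =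
      (mk (Z 1 2 a) ⊠ mk (wires 1)) ⨟ (mk (dumbbell 4 a) ⊠ (mk (xLeafL 0 (-a)) ⊠ ((mk hBox ⊠ mk (wires 1)) ⨟ mk (Z 2 1 (-1)) ⨟ mk (xLeafL 4 1)))) from by
        rw [scalar_par_seq_right, empty_par, cast_id],
    show mk (dumbbell 4 a) ⊠ (mk (xLeafL 0 (-a)) ⊠ ((mk hBox ⊠ mk (wires 1)) ⨟ mk (Z 2 1 (-1)) ⨟ mk (xLeafL 4 1))) = mk (dumbbell 0 0) ⊠ (mk (xLeafL 4 a) ⊠ ((mk hBox ⊠ mk (wires 1)) ⨟ mk (Z 2 1 (-1)) ⨟ mk (xLeafL 4 1))) from by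
      rw [show ∀ (s : ZXClass 0 0) (B : ZXClass 2 1), s ⊠ (mk (xLeafL 0 (-a)) ⊠ B) = (s ⊠ mk (xLeafL 0 (-a))) ⊠ B from fun s B => (par_assoc' _ _ _).trans (cast_id _ _ _), hKl]
      exact (par_assoc _ _ _).trans (cast_id _ _ _),
    show (mk (Z 1 2 a) ⊠ mk (wires 1)) ⨟ (mk (dumbbell 0 0) ⊠ (mk (xLeafL 4 a) ⊠ ((mk hBox ⊠ mk (wires 1)) ⨟ mk (Z 2 1 (-1)) ⨟ mk (xLeafL 4 1)))) =
      mk (dumbbell 0 0) ⊠ ((mk (Z 1 2 a) ⊠ mk (wires 1)) ⨟ (mk (xLeafL 4 a) ⊠ ((mk hBox ⊠ mk (wires 1)) ⨟ mk (Z 2 1 (-1)) ⨟ mk (xLeafL 4 1)))) from by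
        rw [scalar_par_seq_right, empty_par, cast_id],
    scalar_par_two_two_seq_one, ← scalar_par_two_two_seq_one (mk (dumbbell 0 0)) _ (mk (Z 2 1 0)),
    show mk (dumbbell 0 0) ⊠ ((mk (Z 1 2 a) ⊠ mk (wires 1)) ⨟ (mk (xLeafL 4 a) ⊠ ((mk hBox ⊠ mk (wires 1)) ⨟ mk (Z 2 1 (-1)) ⨟ mk (xLeafL 4 1)))) =
      (mk (Z 1 2 a) ⊠ mk (wires 1)) ⨟ (mk (xLeafL 4 a) ⊠ ((mk hBox ⊠ mk (wires 1)) ⨟ mk (Z 2 1 (-1)) ⨟ (mk (dumbbell 0 0) ⊠ mk (xLeafL 4 1)))) from by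
        rw [seq_scalar_par_one', scalar_par_right_one, scalar_par_seq_right, empty_par, cast_id],
    hKr, seq_scalar_par_one', scalar_par_right_one, show ∀ Y : ZXClass 3 2, (mk (Z 1 2 a) ⊠ mk (wires 1)) ⨟ (mk (dumbbell 4 1) ⊠ Y) = mk (dumbbell 4 1) ⊠ ((mk (Z 1 2 a) ⊠ mk (wires 1)) ⨟ Y) from
      fun Y => by rw [scalar_par_seq_right, empty_par, cast_id],
    scalar_par_two_two_seq_one, xLeafL_eq_xLeafR 0 (-1), hS,
    -- (C1)
    ← id_seq ((mk (Z 1 2 a) ⊠ mk (Z 1 2 (-1))) ⨟ ((mk (wires 1) ⊠ ((mk hBox ⊠ mk (wires 1)) ⨟ mk cap)) ⊠ mk (wires 1)) ⨟ (mk (xLeafL 4 a) ⊠ mk (xLeafR 0 (-1))) ⨟ mk (Z 2 1 0)), ← hBox_par_seq_hBox_par, seq_assoc (mk hBox ⊠ mk (wires 1)),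
    ← seq_assoc (mk hBox ⊠ mk (wires 1)) ((mk (Z 1 2 a) ⊠ mk (Z 1 2 (-1))) ⨟ ((mk (wires 1) ⊠ ((mk hBox ⊠ mk (wires 1)) ⨟ mk cap)) ⊠ mk (wires 1)) ⨟ (mk (xLeafL 4 a) ⊠ mk (xLeafR 0 (-1)))) (mk (Z 2 1 0)),
    ← seq_assoc (mk hBox ⊠ mk (wires 1)) ((mk (Z 1 2 a) ⊠ mk (Z 1 2 (-1))) ⨟ ((mk (wires 1) ⊠ ((mk hBox ⊠ mk (wires 1)) ⨟ mk cap)) ⊠ mk (wires 1))) _, ← seq_assoc (mk hBox ⊠ mk (wires 1)) (mk (Z 1 2 a) ⊠ mk (Z 1 2 (-1))) _,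
    c1Gadget_eq_mirror, ← xLeafL_eq_xLeafR 4 a]
  simp only [seq_assoc]
  rw [← seq_assoc (mk hBox ⊠ mk (wires 1)) (mk (wires 1) ⊠ mk hBox), show (mk hBox ⊠ mk (wires 1)) ⨟ (mk (wires 1) ⊠ mk hBox) = mk hBox ⊠ mk hBox from by rw [← par_eq_seq_left],
    ← xLeafL_eq_xLeafR 0 (-1)]
  where
  seq_scalar_par_one' (A : ZXClass 2 1) (s : ZXClass 0 0) (B : ZXClass 1 1) : A ⨟ (s ⊠ B) = s ⊠ (A ⨟ B) := by
    rw [scalar_par_seq_right, empty_par, cast_id]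
  seq_scalar_par_one'' (A : ZXClass 2 1) (s : ZXClass 0 0) (B : ZXClass 1 1) : A ⨟ (s ⊠ B) = s ⊠ (A ⨟ B) := by
    rw [scalar_par_seq_right, empty_par, cast_id]
  scalar_par_right_one (s : ZXClass 0 0) (B : ZXClass 2 1) : mk (xLeafL 4 a) ⊠ (s ⊠ B) = s ⊠ (mk (xLeafL 4 a) ⊠ B) := by
    rw [show mk (xLeafL 4 a) ⊠ (s ⊠ B) = (mk (xLeafL 4 a) ⊠ s) ⊠ B from (par_assoc' _ _ _).trans (cast_id _ _ _), ← scalar_par_one_comm]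
    exact (par_assoc _ _ _).trans (cast_id _ _ _)

/-! ### The (C1) gadget with the `π` moved across the merge, and the junk identity -/

/-- A red `π` on the second input of a merge moves to the first input and the output. [cite: JeandelPerdrixVilmart2018, Fig. 1 (K1)] -/
theorem par_X_pi_seq_Z_merge : (mk (wires 1) ⊠ mk (X 1 1 4)) ⨟ mk (Z 2 1 0) = (mk (X 1 1 4) ⊠ mk (wires 1)) ⨟ mk (Z 2 1 0) ⨟ mk (X 1 1 4) := by
  rw [X_pi_par_seq_Z_merge, seq_assoc, seq_assoc, xphase_seq_xphase, show (4 : ZMod 8) + 4 = 0 from by decide, X_one_one, seq_id]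

/-- `xLeafL π a = xLeafL 0 a ⨾ X(π)` (the red phase slides to the through output). [cite: JeandelPerdrixVilmart2018, Fig. 1 (S1)] -/
theorem xLeafL_four_eq_seq_X_pi (a : ZMod 8) : mk (xLeafL 4 a) = mk (xLeafL 0 a) ⨟ mk (X 1 1 4) := by
  rw [← xLeafL_zero_seq_X_pi]

/-- `xLeafR π b = xLeafR 0 b ⨾ X(π)`. [cite: JeandelPerdrixVilmart2018, Fig. 1 (S1)] -/
theorem xLeafR_four_eq_seq_X_pi (b : ZMod 8) : mk (xLeafR 4 b) = mk (xLeafR 0 b) ⨟ mk (X 1 1 4) := by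
  rw [← xLeafL_eq_xLeafR, ← xLeafL_eq_xLeafR, xLeafL_four_eq_seq_X_pi]

/-- **(C1) with the `π` on the other leaves**:
`(H ⊗ 𝕀) ⨾ (Z^{(1,2)}(α) ⊗ Z^{(1,2)}(β)) ⨾ hedge ⨾ (xLeafL 0 α ⊗ xLeafR π β) ⨾ Z^{(2,1)}` equals its mirror image
`(𝕀 ⊗ H) ⨾ (Z^{(1,2)}(β) ⊗ Z^{(1,2)}(α)) ⨾ hedge ⨾ (xLeafL π β ⊗ xLeafR 0 α) ⨾ Z^{(2,1)}`. [cite: JeandelPerdrixVilmart2018, Appendix Lemma 17] -/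
theorem c1_tilde (a b : ZMod 8) :
    (mk hBox ⊠ mk (wires 1)) ⨟ (mk (Z 1 2 a) ⊠ mk (Z 1 2 b)) ⨟ ((mk (wires 1) ⊠ ((mk hBox ⊠ mk (wires 1)) ⨟ mk cap)) ⊠ mk (wires 1)) ⨟ (mk (xLeafL 0 a) ⊠ mk (xLeafR 4 b)) ⨟ mk (Z 2 1 0) =
      (mk (wires 1) ⊠ mk hBox) ⨟ (mk (Z 1 2 b) ⊠ mk (Z 1 2 a)) ⨟ ((mk (wires 1) ⊠ ((mk hBox ⊠ mk (wires 1)) ⨟ mk cap)) ⊠ mk (wires 1)) ⨟ (mk (xLeafL 4 b) ⊠ mk (xLeafR 0 a)) ⨟ mk (Z 2 1 0) := by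
  have hL : ∀ p q : ZMod 8, (mk (xLeafL 0 p) ⊠ mk (xLeafR 4 q)) ⨟ mk (Z 2 1 0) = (mk (xLeafL 4 p) ⊠ mk (xLeafR 0 q)) ⨟ mk (Z 2 1 0) ⨟ mk (X 1 1 4) := fun p q => by
    rw [xLeafR_four_eq_seq_X_pi, show mk (xLeafL 0 p) ⊠ (mk (xLeafR 0 q) ⨟ mk (X 1 1 4)) = (mk (xLeafL 0 p) ⊠ mk (xLeafR 0 q)) ⨟ (mk (wires 1) ⊠ mk (X 1 1 4)) from by
        rw [← seq_id (mk (xLeafL 0 p)), ← interchange, seq_id],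
      seq_assoc, par_X_pi_seq_Z_merge, ← seq_assoc, ← seq_assoc, show (mk (xLeafL 0 p) ⊠ mk (xLeafR 0 q)) ⨟ (mk (X 1 1 4) ⊠ mk (wires 1)) = mk (xLeafL 4 p) ⊠ mk (xLeafR 0 q) from by
        rw [xLeafL_four_eq_seq_X_pi, ← seq_id (mk (xLeafR 0 q)), ← interchange, seq_id]]
  have hR : ∀ p q : ZMod 8, (mk (xLeafL 4 p) ⊠ mk (xLeafR 0 q)) ⨟ mk (Z 2 1 0) = (mk (xLeafL 0 p) ⊠ mk (xLeafR 4 q)) ⨟ mk (Z 2 1 0) ⨟ mk (X 1 1 4) := fun p q => by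
    rw [hL, seq_assoc, seq_assoc, xphase_seq_xphase, show (4 : ZMod 8) + 4 = 0 from by decide, X_one_one, seq_id]
  rw [seq_assoc _ (mk (xLeafL 0 a) ⊠ mk (xLeafR 4 b)) (mk (Z 2 1 0)), hL, ← seq_assoc, ← seq_assoc, c1Gadget_eq_mirror,
    seq_assoc _ (mk (xLeafL 0 b) ⊠ mk (xLeafR 4 a)) (mk (Z 2 1 0)), seq_assoc _ ((mk (xLeafL 0 b) ⊠ mk (xLeafR 4 a)) ⨟ mk (Z 2 1 0)) (mk (X 1 1 4)),
    seq_assoc (mk (xLeafL 0 b) ⊠ mk (xLeafR 4 a)) (mk (Z 2 1 0)) (mk (X 1 1 4)), ← seq_assoc (mk (xLeafL 0 b) ⊠ mk (xLeafR 4 a)) (mk (Z 2 1 0)), ← hR, ← seq_assoc]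

/-- Feeding a state with phase `b` through the hedge: `(𝕀 ⊗ Z^{(0,2)}(b)) ⨾ (H∪ᵗ ⊗ 𝕀) = H ⨾ Z(b)`. [cite: JeandelPerdrixVilmart2018, §2.2] -/
theorem par_Z_zero_two_seq_hcap_par (b : ZMod 8) : (mk (wires 1) ⊠ mk (Z 0 2 b)) ⨟ (((mk hBox ⊠ mk (wires 1)) ⨟ mk cap) ⊠ mk (wires 1)) = mk hBox ⨟ mk (Z 1 1 b) := by
  rw [seq_par_wires, ← seq_assoc, show (mk hBox ⊠ mk (wires 1)) ⊠ mk (wires 1) = mk hBox ⊠ mk (wires 2) from by rw [← wires_par_wires 1 1]; exact (par_assoc _ _ _).trans (cast_id _ _ _),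
    show (mk (wires 1) ⊠ mk (Z 0 2 b)) ⨟ (mk hBox ⊠ mk (wires 2)) = mk hBox ⨟ (mk (wires 1) ⊠ mk (Z 0 2 b)) from by
      rw [interchange, id_seq, seq_id, par_eq_seq_left (mk hBox) (mk (Z 0 2 b)), par_empty],
    seq_assoc, Z_zero_two_eq_cup_par_phase, wires_par_seq, seq_assoc,
    show (mk (wires 1) ⊠ (mk (wires 1) ⊠ mk (Z 1 1 b))) ⨟ (mk cap ⊠ mk (wires 1)) = (mk cap ⊠ mk (wires 1)) ⨟ mk (Z 1 1 b) from by
      rw [show mk (wires 1) ⊠ (mk (wires 1) ⊠ mk (Z 1 1 b)) = mk (wires 2) ⊠ mk (Z 1 1 b) from by rw [← wires_par_wires 1 1]; exact (par_assoc' _ _ _).trans (cast_id _ _ _),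
        interchange, id_seq, seq_id, par_eq_seq_left (mk cap) (mk (Z 1 1 b)), empty_par, cast_id],
    ← seq_assoc (mk (wires 1) ⊠ mk cup), snake_left, id_seq]

/-- **The junk identity** of `control-alpha-with-triangles`: the remnant of the unfused `(2α+π)`-node is absorbed,
`H ⨾ Z^{(1,2)}(α) ⨾ ((H ⨾ Z(-π/4) ⨾ xLeafL 0 (π/4)) ⊗ xLeafL 0 α) ⨾ Z^{(2,1)} = 1/√2 ⊗ (Z(-π/4) ⨾ xLeafL 0 (π/4) ⨾ Z(α))`;
it is (C1) with its second input fed by `Z^{(0,1)}`. [cite: JeandelPerdrixVilmart2018, Appendix Lemma 17; Fig. 1 (B1)] -/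
theorem junk (a : ZMod 8) :
    mk hBox ⨟ mk (Z 1 2 a) ⨟ ((mk hBox ⨟ mk (Z 1 1 (-1)) ⨟ mk (xLeafL 0 1)) ⊠ mk (xLeafL 0 a)) ⨟ mk (Z 2 1 0) =
      mk invSqrtTwo ⊠ (mk (Z 1 1 (-1)) ⨟ mk (xLeafL 0 1) ⨟ mk (Z 1 1 a)) := by
  -- feeding the left-hand side of `c1_tilde a (-1)`
  have hfedL : (mk (wires 1) ⊠ mk (Z 0 1 0)) ⨟ ((mk hBox ⊠ mk (wires 1)) ⨟ (mk (Z 1 2 a) ⊠ mk (Z 1 2 (-1))) ⨟ ((mk (wires 1) ⊠ ((mk hBox ⊠ mk (wires 1)) ⨟ mk cap)) ⊠ mk (wires 1)) ⨟ (mk (xLeafL 0 a) ⊠ mk (xLeafR 4 (-1))) ⨟ mk (Z 2 1 0)) =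
      mk hBox ⨟ mk (Z 1 2 a) ⨟ (mk (xLeafL 0 a) ⊠ (mk hBox ⨟ mk (Z 1 1 (-1)) ⨟ mk (xLeafR 4 (-1)))) ⨟ mk (Z 2 1 0) := by
    rw [← seq_assoc, ← seq_assoc, ← seq_assoc, ← seq_assoc, interchange, id_seq, seq_id, par_eq_seq_left (mk hBox) (mk (Z 0 1 0)), par_empty,
      seq_assoc (mk hBox), show (mk (wires (1 + 0)) ⊠ mk (Z 0 1 0)) ⨟ (mk (Z 1 2 a) ⊠ mk (Z 1 2 (-1))) = mk (Z 1 2 a) ⊠ mk (Z 0 2 (-1)) from by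
        rw [show mk (wires (1 + 0)) = mk (wires 1) from rfl, interchange, id_seq, Z_seq_Z 0 1 2 le_rfl, zero_add],
      par_eq_seq_left (mk (Z 1 2 a)) (mk (Z 0 2 (-1))), par_empty,
      show mk (wires (2 + 0)) ⊠ mk (Z 0 2 (-1)) = mk (wires 1) ⊠ (mk (wires 1) ⊠ mk (Z 0 2 (-1))) from by
        rw [show mk (wires (2 + 0)) = mk (wires 2) from rfl, ← wires_par_wires 1 1]; exact (par_assoc _ _ _).trans (cast_id _ _ _),
      show ((mk (wires 1) ⊠ ((mk hBox ⊠ mk (wires 1)) ⨟ mk cap)) ⊠ mk (wires 1)) = mk (wires 1) ⊠ (((mk hBox ⊠ mk (wires 1)) ⨟ mk cap) ⊠ mk (wires 1)) from (par_assoc _ _ _).trans (cast_id _ _ _)]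
    simp only [seq_assoc]
    rw [← seq_assoc (mk (wires 1) ⊠ (mk (wires 1) ⊠ mk (Z 0 2 (-1)))), ← wires_par_seq, par_Z_zero_two_seq_hcap_par, ← seq_assoc (mk (wires 1) ⊠ (mk hBox ⨟ mk (Z 1 1 (-1)))),
      show (mk (wires 1) ⊠ (mk hBox ⨟ mk (Z 1 1 (-1)))) ⨟ (mk (xLeafL 0 a) ⊠ mk (xLeafR 4 (-1))) = mk (xLeafL 0 a) ⊠ (mk hBox ⨟ (mk (Z 1 1 (-1)) ⨟ mk (xLeafR 4 (-1)))) from by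
        rw [interchange, id_seq, seq_assoc]]
  -- feeding the right-hand side
  have hB1 : mk (X 0 1 0) ⨟ mk (Z 1 2 a) = mk invSqrtTwo ⊠ (mk (X 0 1 0) ⊠ mk (X 0 1 0)) := by
    have h := congrArg (mk invSqrtTwo ⊠ ·) rule_B1
    rw [show mk invSqrtTwo ⊠ (mk (dumbbell 0 0) ⊠ (mk (X 0 1 0) ⨟ mk (Z 1 2 0))) = mk (X 0 1 0) ⨟ mk (Z 1 2 0) from by
      rw [show mk invSqrtTwo ⊠ (mk (dumbbell 0 0) ⊠ (mk (X 0 1 0) ⨟ mk (Z 1 2 0))) = (mk invSqrtTwo ⊠ mk (dumbbell 0 0)) ⊠ (mk (X 0 1 0) ⨟ mk (Z 1 2 0)) from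
        (par_assoc' _ _ _).trans (cast_id _ _ _), invSqrtTwo_par_dumbbell, empty_par, cast_id]] at h
    rw [show mk (Z 1 2 a) = mk (Z 1 1 a) ⨟ mk (Z 1 2 0) from by rw [Z_seq_Z 1 1 2 le_rfl, add_zero], ← seq_assoc, X_state_zero_seq_Z_phase, h]
  have hXcap : (mk (wires 1) ⊠ mk (X 0 1 0)) ⨟ ((mk hBox ⊠ mk (wires 1)) ⨟ mk cap) = mk (Z 1 0 0) := by
    rw [← seq_assoc, show (mk (wires 1) ⊠ mk (X 0 1 0)) ⨟ (mk hBox ⊠ mk (wires 1)) = mk hBox ⨟ (mk (wires 1) ⊠ mk (X 0 1 0)) from by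
        rw [interchange, id_seq, seq_id, par_eq_seq_left (mk hBox) (mk (X 0 1 0)), par_empty],
      seq_assoc, par_xstate_seq_cap, X_effect_eq, ← seq_assoc, hBox_seq_hBox, id_seq]
  have hfedR : (mk (wires 1) ⊠ mk (Z 0 1 0)) ⨟ ((mk (wires 1) ⊠ mk hBox) ⨟ (mk (Z 1 2 (-1)) ⊠ mk (Z 1 2 a)) ⨟ ((mk (wires 1) ⊠ ((mk hBox ⊠ mk (wires 1)) ⨟ mk cap)) ⊠ mk (wires 1)) ⨟ (mk (xLeafL 4 (-1)) ⊠ mk (xLeafR 0 a)) ⨟ mk (Z 2 1 0)) =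
      mk invSqrtTwo ⊠ (mk (Z 1 1 (-1)) ⨟ mk (xLeafL 4 (-1)) ⨟ mk (Z 1 1 a)) := by
    rw [← seq_assoc, ← seq_assoc, ← seq_assoc, ← seq_assoc, ← wires_par_seq, ← X_state_eq, interchange, id_seq, hB1,
      show mk (Z 1 2 (-1)) ⊠ (mk invSqrtTwo ⊠ (mk (X 0 1 0) ⊠ mk (X 0 1 0))) = mk invSqrtTwo ⊠ ((mk (Z 1 2 (-1)) ⊠ mk (X 0 1 0)) ⊠ mk (X 0 1 0)) from by
        rw [show mk (Z 1 2 (-1)) ⊠ (mk invSqrtTwo ⊠ (mk (X 0 1 0) ⊠ mk (X 0 1 0))) = (mk (Z 1 2 (-1)) ⊠ mk invSqrtTwo) ⊠ (mk (X 0 1 0) ⊠ mk (X 0 1 0)) from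
            (par_assoc' _ _ _).trans (cast_id _ _ _), ← scalar_par_one_two_comm]
        exact ((par_assoc _ _ _).trans (cast_id _ _ _)).trans (congrArg _ ((par_assoc' _ _ _).trans (cast_id _ _ _))),
      mv_14, mv_13', mv_12, show ((mk (wires 1) ⊠ ((mk hBox ⊠ mk (wires 1)) ⨟ mk cap)) ⊠ mk (wires 1)) = (mk (wires 1) ⊠ ((mk hBox ⊠ mk (wires 1)) ⨟ mk cap)) ⊠ mk (wires 1) from rfl, interchange, seq_id,
      par_eq_seq_left (mk (Z 1 2 (-1))) (mk (X 0 1 0)), par_empty, seq_assoc,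
      show mk (wires (2 + 0)) ⊠ mk (X 0 1 0) = mk (wires 1) ⊠ (mk (wires 1) ⊠ mk (X 0 1 0)) from by rw [show mk (wires (2 + 0)) = mk (wires 2) from rfl, ← wires_par_wires 1 1]; exact (par_assoc _ _ _).trans (cast_id _ _ _),
      seq_assoc (mk (Z 1 2 (-1))) (mk (wires 1) ⊠ (mk (wires 1) ⊠ mk (X 0 1 0))), ← wires_par_seq, hXcap, show mk (Z 1 2 (-1)) ⨟ (mk (wires 1) ⊠ mk (Z 1 0 0)) = mk (Z 1 1 (-1)) from by rw [Z_seq_par_Z 1 1 1 0 le_rfl, add_zero (-1 : ZMod 8)],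
      ← seq_assoc, interchange, show mk (X 0 1 0) ⨟ mk (xLeafR 0 a) = mk (Z 0 1 a) from by
        simp only [xLeafR, mk_seq, mk_par]; rw [← seq_assoc, X_seq_X 0 1 2 le_rfl, add_zero, X_zero_two, cup_seq_par_effect],
      par_eq_seq_left (mk (Z 1 1 (-1)) ⨟ mk (xLeafL 4 (-1))) (mk (Z 0 1 a)), par_empty, seq_assoc,
      show (mk (wires (1 + 0)) ⊠ mk (Z 0 1 a)) ⨟ mk (Z 2 1 0) = mk (Z 1 1 a) from by rw [show mk (wires (1 + 0)) = mk (wires 1) from rfl, par_Z_seq_Z 1 0 1 1 le_rfl, zero_add]]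
  have hK : mk (dumbbell 4 (-1)) ⊠ mk (xLeafL 0 1) = mk (dumbbell 0 0) ⊠ mk (xLeafL 4 (-1)) := by simpa using (dumbbell_four_par_xLeafL_neg 0 (-1))
  refine cancel_dumbbell_four_one_one (-1) ?_
  rw [← scalar_par_one_two_seq_one (mk (dumbbell 4 (-1))), ← mv_a _ (mk (dumbbell 4 (-1))), ← scalar_par_one_par_one, ← seq_scalar_par_one (mk (dumbbell 4 (-1))) (mk hBox ⨟ mk (Z 1 1 (-1))),
    hK, seq_scalar_par_one, scalar_par_one_par_one, mv_a, scalar_par_one_two_seq_one,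
    show mk (Z 1 2 a) = mk (Z 1 2 a) ⨟ mk swap from (Z_seq_swap 1 a).symm, seq_assoc (mk hBox) (mk (Z 1 2 a) ⨟ mk swap), seq_assoc (mk (Z 1 2 a)) (mk swap),
    swap_seq_par_one_one, ← seq_assoc (mk (Z 1 2 a)), ← seq_assoc (mk hBox), seq_assoc _ (mk swap) (mk (Z 2 1 0)), swap_seq_Z, xLeafL_eq_xLeafR 4 (-1),
    ← seq_assoc (mk hBox) (mk (Z 1 2 a)), ← hfedL, c1_tilde, hfedR, sqrt_two_par_invSqrtTwo_par_one,
    scalar_par_scalar_par (mk (dumbbell 4 (-1))) (mk invSqrtTwo), ← scalar_par_seq_one (mk (dumbbell 4 (-1))) (mk (Z 1 1 (-1)) ⨟ mk (xLeafL 0 1)),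
    ← seq_scalar_par_one (mk (dumbbell 4 (-1))) (mk (Z 1 1 (-1))), hK, seq_scalar_par_one, scalar_par_seq_one, invSqrtTwo_par_sqrt_two_par_one, xLeafL_eq_xLeafR 4 (-1)]
  where
  mv_14 (s : ZXClass 0 0) (A : ZXClass 1 4) (B : ZXClass 4 2) : (s ⊠ A) ⨟ B = s ⊠ (A ⨟ B) := by rw [scalar_par_seq_left, empty_par, cast_id]
  mv_13' (s : ZXClass 0 0) (A : ZXClass 1 2) (B : ZXClass 2 2) : (s ⊠ A) ⨟ B = s ⊠ (A ⨟ B) := by rw [scalar_par_seq_left, empty_par, cast_id]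
  mv_12 (s : ZXClass 0 0) (A : ZXClass 1 2) (B : ZXClass 2 1) : (s ⊠ A) ⨟ B = s ⊠ (A ⨟ B) := by rw [scalar_par_seq_left, empty_par, cast_id]

end ZXClass

end Literature.Computability.QuantumComplexity
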